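import Literature.Combinatorics.Optimization.PatternMatrixPsdRank
import Literature.Combinatorics.Optimization.PsdRankBasicProperties
import Literature.LinearAlgebra.Matrix.NearestPositiveSemidefinite
import Literature.Analysis.Convex.ConeLift
import Literature.Analysis.Convex.LinearProgrammingDuality
import Literature.Computation.Certificates.SDPFaceReduction
import HarnessLib

/-!
# Psd lifts, slack matrices of pairs of polytopes, and the geometric meaning of psd rank (FGPRT 2015, §§3–4)

Source: H. Fawzi, J. Gouveia, P. A. Parrilo, R. Z. Robinson, R. R. Thomas, *Positive semidefinite
rank*, Math. Program. Ser. B 153 (2015) 133–177 = arXiv:1407.4095 [FawziEtAl2015], §3 "Motivation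
and examples" and §4 "Psd rank two and convex programming" (held text `paper:arxiv-1407.4095`, chunks
p09–p13; arXiv numbering), with Proposition 5.12 of §5.2 (p16), which is a statement about psd lifts.
Secondary: J. Gouveia, R. Z. Robinson, R. R. Thomas, *Worst-case results for positive semidefinite
rank*, Math. Program. 153 (2015) = arXiv:1305.4600, Def. 3.5 / Prop. 3.6 (held text
`paper:arxiv-1305.4600` p06–p07), whose proof FGPRT's Theorem 3.3 cites.

Vocabulary: the tree's `HasPsdFactorization M k` ("`rank_psd(M) ≤ k`"). New here:
* `HasPsdLift C k` — FGPRT eq. (3) (p09): "`P = π(S^k_+ ∩ L)` where `L ⊂ S^k` is an affine subspace and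
  `π` is a linear map … is called a psd lift of size `k`" — the Gouveia–Parrilo–Thomas form. (The tree's
  `Literature.AlgebraicGeometry.HyperbolicPolynomials.IsSpectrahedralShadowOfSize` and
  `Literature.Analysis.Convex.HasExpPsdLift · 0 m` are the lifted-LMI form `{x | ∃ y, A(x,y) + B ⪰ 0}`;
  the two agree up to an additive constant in the size and agree EXACTLY for full-dimensional bounded
  sets, but not for lower-dimensional ones — a point `{x₀}`, `x₀ ≠ 0`, has a GPT lift of size `1` and
  no lifted-LMI description of size `1` — and Theorem 3.3 is size-exact, hence the separate notion.)
* `pairSlackMatrix x a b` — Definition 3.1 (p09): the slack matrix `S_{P,Q}`, `(i,j) ↦ b_j − a_jᵀ x_i`,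
  of `P = conv(x_1,…,x_v)` inside `Q = {x : a_jᵀ x ≤ b_j}`.

Contents.
* Theorem 3.3, case `P = Q` (p09: "the size of the smallest psd lift of a polytope `P` is equal to the
  psd rank of the slack matrix `S_P`"): NAMED FACT `FawziEtAl2015_thm33`, DISCHARGED
  (`FawziEtAl2015_thm33_holds`).
* Theorem 3.3 for pairs `P ⊆ Q` with `Q` a full-dimensional POLYTOPE: NAMED FACT
  `FawziEtAl2015_thm33_pair`, DISCHARGED (`FawziEtAl2015_thm33_pair_holds`; full-dimensionality is not
  used). Both rest on the two directions proved here for points `x_i` in a psd lift `C` inside a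
  BOUNDED polyhedron `Q`: `HasPsdLift.hasPsdFactorization_pairSlackMatrix` ("lift ⇒ factorization":
  preimages `A_i` of the `x_i`, and `B_j = U_j + μ_j E` from the tree's Slater-free SDP certificate
  `SDPFaceReduction.exists_posSemidef_certificate_of_lowerBound` — facial reduction + strong duality,
  here `exists_posSemidef_certificate_of_le_on_psdLift` — with the constants `μ_j ≥ 0` absorbed by a psd
  `E` pairing to `1` on the lift, built from LP multipliers of `±(y₁ − y₂)`, `LPDuality`) and
  `HasPsdFactorization.exists_hasPsdLift_between` ("factorization ⇒ lift": the printed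
  `C = {y : ∃ M ⪰ 0, b_j − a_jᵀy = ⟨M, B_j⟩}` written as `π(S^k_+ ∩ L)` with `π` linear).
  Scope note (ours, checked on examples while typing): as printed
  ("`Q` a polyhedron", any inequality description, `π` linear) the pair statement fails in degenerate
  unbounded cases — `P = [1,2] ⊂ Q = {x ≥ 0, x ≥ −1} ⊂ ℝ`: `S_{P,Q} = [[1,2],[2,3]]` has rank `2` hence
  psd rank `2`, while `Q` itself is a size-`1` lift sandwiched between `P` and `Q`; and `P = [1,2] ⊂
  Q = {x ≥ 1}`: `S_{P,Q} = [[0],[1]]` has psd rank `1` while no `π(S^1_+ ∩ L)` with `π` LINEAR lies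
  between them — so only the bounded case (the one used in §4, where Lemma 4.1 makes `Q` bounded) is
  vendored; GRT Prop. 3.6 adds "`P` full-dimensional, `Q` contains no lines" and translates `0` into
  `int P`.
* Remark 3.4 / Lemma 4.1 (Gillis–Glineur: every nonnegative `M` with `M𝟙 = 𝟙` and `rank M = r` is the
  slack matrix of a pair of BOUNDED polytopes `P ⊆ Q ⊂ ℝ^{r−1}`): NAMED FACT `FawziEtAl2015_lemma41`,
  DISCHARGED (`FawziEtAl2015_lemma41_holds`: an orthonormal affine parametrisation of the row space,
  `dim span{m_i − m_{i₀}} = rank M − 1`, and `‖y‖₂² ≤ q` on `Q`).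
* §4 (p13, from GRT13): for `rank M = 3`, written as `S_{P,Q}` of planar polytopes, `rank_psd M = 2`
  iff an ellipse is sandwiched between `P` and `Q`: NAMED FACT `FawziEtAl2015_sec4_ellipse`, DISCHARGED
  (`FawziEtAl2015_sec4_ellipse_holds`: "⇐" every ellipse region has a psd lift of size `2`,
  `hasPsdLift_ellipse`, then Theorem 3.3; "⇒" Theorem 3.3 gives a sandwiched size-`2` lift and
  `exists_ellipse_of_hasPsdLift_two` shows it is a nondegenerate ellipse region — the GRT13 argument
  "`L` is a two-dimensional slice, `π|_L` invertible, `S^2_+` is the second-order cone").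
  Lemma 4.2 (S-lemma) is the tree's `Literature.Analysis.Convexity.sLemma` (which carries the
  strict-feasibility hypothesis the survey's statement omits; without it the printed Lemma 4.2 fails,
  e.g. `x² ≤ 0 ⇒ x ≤ 0` on `ℝ`).
* Proposition 3.8 (Jain–Shi–Wei–Zhang: psd factorizations of size `k` of a joint distribution `M` =
  quantum correlation-generation protocols with `log k` qubits, real-symmetric version as in the
  survey): NAMED FACT `FawziEtAl2015_prop38`, DISCHARGED (`FawziEtAl2015_prop38_holds`: (ii) ⇒ (i) by the
  partial trace `Tr_1((F_i ⊗ I)ρ)`, `HasPsdFactorization.of_kronecker_trace`; (i) ⇒ (ii) by the congruence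
  normalisation `exists_posSemidef_sum_eq_one_congr` of `PsdRankBasicProperties.lean` and a pure state).
* Proposition 5.12 (Gouveia–Parrilo–Thomas: a full-dimensional convex set with a `S^k_+`-lift has
  algebraic boundary of degree `≤ k^{O(k²n)}`): NAMED FACT `FawziEtAl2015_prop512`; PROVED modulo
  Renegar's quantifier elimination (Thm 5.11) as
  `Literature.Combinatorics.Optimization.FawziEtAl2015_prop512_of_qe` in `PsdLiftAlgebraicBoundary.lean`,
  where the qualitative statement (a nonzero polynomial vanishing on the boundary) is unconditional
  (`HasPsdLift.exists_ne_zero_eval_eq_zero_of_mem_frontier`).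
* PROVED API: `pairSlackMatrix_nonneg` (Def. 3.1: `S_{P,Q}` is nonnegative when `P ⊆ Q`),
  `HasPsdLift.mono`, `hasPsdLift_singleton` (a point has a psd lift of every size `k ≥ 1`),
  `hasPsdLift_empty`, `HasPsdFactorization.pairSlackMatrix_submatrix` (psd factorizations of `S_{P,Q}`
  restrict to sub-descriptions — the submatrix remark behind Remark 3.2 and Ex. 5.1).
* Corollary 5.9, rank part (`rank(S_P) = dim P + 1` for an `n`-dimensional polytope given by vertices
  and facet inequalities): PROVED, `rank_pairSlackMatrix_eq_finrank_add_one` (row space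
  `= L(lin P) ⊕ ℝ s_{i₀}` with `L w = (−a_jᵀw)_j`, injectivity and `s_{i₀} ∉ L(lin P)` from the
  boundedness of `P`); the psd-rank part of Cor. 5.9 stays the NAMED FACT `FawziEtAl2015_cor59`
  (`PsdRankComparisons.lean`, Lee–Theis support bound).

NOT here: Examples 3.5/3.6 (square, nested rectangles — both PROVED in `PsdRankWorkedExamples.lean`:
`squareSlackMatrix_rank_and_psdRank`, `hasPsdLift_square_three`, `nestedRectangles_psdRank`), §3.2.1's
protocol narrative, Remark 3.7.
-/

noncomputable section

open Matrix Finset Set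
open scoped MatrixOrder Kronecker

namespace Literature.Combinatorics.Optimization

open Literature.Analysis.Convex (selMatrix padMatrix padMatrix_apply posSemidef_padMatrix_iff
  selMatrix_transpose_mul_self)
open Literature.LinearAlgebra.Matrix.NearestPositiveSemidefinite (trace_mul_nonneg)

/-! ### Psd lifts (Gouveia–Parrilo–Thomas form) -/

/-- **Psd lift of size `k`** (FGPRT eq. (3), p09, verbatim): "`P = π(S^k_+ ∩ L)` where `L ⊂ S^k` is an
affine subspace and `π` is a linear map … A representation of the polytope `P` of the form (3) is
called a psd lift of size `k`." Here `S^k_+ ∩ L` is `{M : M ⪰ 0, M ∈ L}` for an affine subspace `L` of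
all real `k × k` matrices (Mathlib's `PosSemidef` includes symmetry, so this is the same family of
sets). [cite: FawziEtAl2015, §3.1 eq. (3) (p09)] -/
def HasPsdLift {E : Type*} [AddCommGroup E] [Module ℝ E] (C : Set E) (k : ℕ) : Prop :=
  ∃ (L : AffineSubspace ℝ (Matrix (Fin k) (Fin k) ℝ)) (π : Matrix (Fin k) (Fin k) ℝ →ₗ[ℝ] E),
    C = π '' {M | M.PosSemidef ∧ M ∈ L}

/-- Unfolding of `HasPsdLift`. [cite: FawziEtAl2015, §3.1 eq. (3) (p09)] -/
theorem hasPsdLift_iff {E : Type*} [AddCommGroup E] [Module ℝ E] (C : Set E) (k : ℕ) :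
    HasPsdLift C k ↔ ∃ (L : AffineSubspace ℝ (Matrix (Fin k) (Fin k) ℝ))
      (π : Matrix (Fin k) (Fin k) ℝ →ₗ[ℝ] E), C = π '' {M | M.PosSemidef ∧ M ∈ L} :=
  Iff.rfl

/-- The empty set has a psd lift of every size (`L = ⊥`). [cite: FawziEtAl2015, §3.1 eq. (3) (p09)] -/
theorem hasPsdLift_empty {E : Type*} [AddCommGroup E] [Module ℝ E] (k : ℕ) :
    HasPsdLift (∅ : Set E) k := by
  refine ⟨⊥, 0, ?_⟩
  have : {M : Matrix (Fin k) (Fin k) ℝ | M.PosSemidef ∧ M ∈ (⊥ : AffineSubspace ℝ _)} = ∅ :=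
    Set.eq_empty_of_forall_notMem fun M hM => AffineSubspace.notMem_bot (k := ℝ) (V := Matrix (Fin k) (Fin k) ℝ) M hM.2
  rw [this, Set.image_empty]

/-- A point has a psd lift of every size `k ≥ 1`: `L = {I_k}`, `π(M) = tr(M)/k · x₀`.
[cite: FawziEtAl2015, §3.1 eq. (3) (p09); Ex. 3.6 (p10, case a = b = 0: rank_psd = 1)] -/
theorem hasPsdLift_singleton {E : Type*} [AddCommGroup E] [Module ℝ E] (x₀ : E) {k : ℕ} (hk : 1 ≤ k) :
    HasPsdLift ({x₀} : Set E) k := by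
  classical
  let L : AffineSubspace ℝ (Matrix (Fin k) (Fin k) ℝ) :=
    AffineSubspace.mk' (1 : Matrix (Fin k) (Fin k) ℝ) ⊥
  let π : Matrix (Fin k) (Fin k) ℝ →ₗ[ℝ] E :=
    (LinearMap.toSpanSingleton ℝ E x₀).comp (((k : ℝ)⁻¹) • Matrix.traceLinearMap (Fin k) ℝ ℝ)
  refine ⟨L, π, ?_⟩
  have hL : ∀ M : Matrix (Fin k) (Fin k) ℝ, M ∈ L ↔ M = 1 := by
    intro M
    simp [L, AffineSubspace.mem_mk', Submodule.mem_bot, sub_eq_zero]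
  have hset : {M : Matrix (Fin k) (Fin k) ℝ | M.PosSemidef ∧ M ∈ L} = {1} := by
    ext M
    simp only [mem_setOf_eq, mem_singleton_iff, hL]
    exact ⟨fun h => h.2, fun h => ⟨h ▸ PosSemidef.one, h⟩⟩
  rw [hset, image_singleton]
  have hk0 : (k : ℝ) ≠ 0 := by exact_mod_cast (Nat.one_le_iff_ne_zero.mp hk)
  simp [π, Matrix.traceLinearMap_apply, hk0]

/-- Psd lifts are monotone in the size: pad `L` by a zero block (`M ↦ M ⊕ 0_{s−k}`, the tree's
`Literature.Analysis.Convex.padMatrix`). [cite: FawziEtAl2015, §3.1 (p09, "smallest k such that P admits a psd lift of size k")] -/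
theorem HasPsdLift.mono {E : Type*} [AddCommGroup E] [Module ℝ E] {C : Set E} {k s : ℕ}
    (h : HasPsdLift C k) (hks : k ≤ s) : HasPsdLift C s := by
  classical
  obtain ⟨L, π, rfl⟩ := h
  let e : Fin k → Fin s := Fin.castLE hks
  have he : Function.Injective e := Fin.castLE_injective hks
  let emb : Matrix (Fin k) (Fin k) ℝ →ₗ[ℝ] Matrix (Fin s) (Fin s) ℝ := padMatrix e
  let proj : Matrix (Fin s) (Fin s) ℝ →ₗ[ℝ] Matrix (Fin k) (Fin k) ℝ :=
    { toFun := fun N => (selMatrix e)ᵀ * N * selMatrix e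
      map_add' := fun N N' => by rw [Matrix.mul_add, Matrix.add_mul]
      map_smul' := fun c N => by rw [Matrix.mul_smul, Matrix.smul_mul, RingHom.id_apply] }
  have hpe : ∀ M, proj (emb M) = M := by
    intro M
    show (selMatrix e)ᵀ * (selMatrix e * M * (selMatrix e)ᵀ) * selMatrix e = M
    calc (selMatrix e)ᵀ * (selMatrix e * M * (selMatrix e)ᵀ) * selMatrix e
        = ((selMatrix e)ᵀ * selMatrix e) * M * ((selMatrix e)ᵀ * selMatrix e) := by
          simp only [Matrix.mul_assoc]
      _ = M := by rw [selMatrix_transpose_mul_self he, Matrix.one_mul, Matrix.mul_one]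
  refine ⟨L.map emb.toAffineMap, π.comp proj, ?_⟩
  ext x
  simp only [mem_image, mem_setOf_eq, LinearMap.coe_comp, Function.comp_apply,
    AffineSubspace.mem_map, LinearMap.coe_toAffineMap]
  constructor
  · rintro ⟨M, ⟨hM, hML⟩, rfl⟩
    exact ⟨emb M, ⟨(posSemidef_padMatrix_iff he).mpr hM, M, hML, rfl⟩, by rw [hpe]⟩
  · rintro ⟨N, ⟨hN, M, hML, rfl⟩, rfl⟩
    exact ⟨M, ⟨(posSemidef_padMatrix_iff he).mp hN, hML⟩, by rw [hpe]⟩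

/-! ### Definition 3.1: slack matrix of a pair of polytopes -/

/-- **FGPRT Definition 3.1** (p09, verbatim): "Let `P ⊂ ℝⁿ` be a polytope and `Q ⊂ ℝⁿ` be a polyhedron
with `P ⊆ Q`. Let `x_1,…,x_v` be such that `P = conv(x_1,…,x_v)` and let `a_j ∈ ℝⁿ, b_j ∈ ℝ`
(`j = 1,…,f`) be such that `Q = {x ∈ ℝⁿ : a_jᵀ x ≤ b_j ∀j}`. Then the slack matrix of the pair `P,Q`,
denoted `S_{P,Q}`, is the nonnegative `v × f` matrix whose `(i,j)`-th entry is `b_j − a_jᵀ x_i`. When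
`P = Q` we write `S_P := S_{P,P}`." (= GRT Def. 3.5, "generalized slack matrix".) The matrix is a
function of the two DESCRIPTIONS (Remark 3.2). [cite: FawziEtAl2015, Def. 3.1 (p09)] -/
def pairSlackMatrix {n v f : ℕ} (x : Fin v → (Fin n → ℝ)) (a : Fin f → (Fin n → ℝ)) (b : Fin f → ℝ) :
    Fin v → Fin f → ℝ :=
  fun i j => b j - a j ⬝ᵥ x i

/-- Entries of the slack matrix of a pair. [cite: FawziEtAl2015, Def. 3.1 (p09)] -/
@[simp] theorem pairSlackMatrix_apply {n v f : ℕ} (x : Fin v → (Fin n → ℝ)) (a : Fin f → (Fin n → ℝ))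
    (b : Fin f → ℝ) (i : Fin v) (j : Fin f) : pairSlackMatrix x a b i j = b j - a j ⬝ᵥ x i := rfl

/-- `S_{P,Q}` is entrywise nonnegative as soon as the points `x_i` lie in `Q` ("the nonnegative `v × f`
matrix", Def. 3.1). [cite: FawziEtAl2015, Def. 3.1 (p09)] -/
theorem pairSlackMatrix_nonneg {n v f : ℕ} {x : Fin v → (Fin n → ℝ)} {a : Fin f → (Fin n → ℝ)}
    {b : Fin f → ℝ} (hx : ∀ i j, a j ⬝ᵥ x i ≤ b j) (i : Fin v) (j : Fin f) :
    0 ≤ pairSlackMatrix x a b i j :=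
  sub_nonneg.mpr (hx i j)

/-- Sub-descriptions: restricting to a subfamily of points and a subfamily of inequalities takes a
submatrix, so psd factorizations restrict (the mechanism behind Remark 3.2 and the step "`D_n` is a
submatrix" of Ex. 5.1). [cite: FawziEtAl2015, Remark 3.2 (p09)] -/
theorem HasPsdFactorization.pairSlackMatrix_submatrix {n v f v' f' : ℕ} {x : Fin v → (Fin n → ℝ)}
    {a : Fin f → (Fin n → ℝ)} {b : Fin f → ℝ} {k : ℕ} (h : HasPsdFactorization (pairSlackMatrix x a b) k)
    (ρ : Fin v' → Fin v) (γ : Fin f' → Fin f) :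
    HasPsdFactorization (pairSlackMatrix (x ∘ ρ) (a ∘ γ) (b ∘ γ)) k := by
  obtain ⟨A, B, hA, hB, hS⟩ := h
  exact ⟨fun i => A (ρ i), fun j => B (γ j), fun i => hA _, fun j => hB _, fun i j => hS _ _⟩

/-! ### Theorem 3.3: psd rank = size of the smallest psd lift -/

/-- **FGPRT Theorem 3.3, case `P = Q`** (p09, verbatim): "Let `P ⊂ ℝⁿ` be a polytope and `Q ⊂ ℝⁿ` be a
polyhedron such that `P ⊆ Q` … Then `rank_psd S_{P,Q}` is the smallest integer `k` for which there
exists an affine subspace `L` of `S^k` and a linear map `π` such that `P ⊆ π(S^k_+ ∩ L) ⊆ Q`"; the text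
singles out "the size of the smallest psd lift of a polytope `P` is equal to the psd rank of the slack
matrix `S_P` of `P` (this is the case `P = Q` of the statement below)" (= Gouveia–Parrilo–Thomas;
GRT Prop. 3.6). Typed for `P = Q`: if `conv(x_1,…,x_v) = {y : a_jᵀy ≤ b_j ∀ j}` (two descriptions of
the same polytope) then for every `k ≥ 1` (sizes are positive integers, §2), `S_P` has a psd
factorization of size `k` iff `P` has a psd lift of size `k`. [cite: FawziEtAl2015, Thm. 3.3 (p09–p10)] -/
def FawziEtAl2015_thm33 : Prop :=
  ∀ (n v f k : ℕ) (x : Fin v → (Fin n → ℝ)) (a : Fin f → (Fin n → ℝ)) (b : Fin f → ℝ), 1 ≤ k →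
    convexHull ℝ (Set.range x) = {y | ∀ j, a j ⬝ᵥ y ≤ b j} →
      (HasPsdFactorization (pairSlackMatrix x a b) k ↔ HasPsdLift (convexHull ℝ (Set.range x)) k)

/-- **FGPRT Theorem 3.3 for a pair `P ⊆ Q` of polytopes** (p09–p10; GRT Prop. 3.6): `rank_psd S_{P,Q}` is
the smallest `k` such that some `π(S^k_+ ∩ L)` is sandwiched between `P` and `Q`. Typed for `Q`
BOUNDED and full-dimensional (the situation of §4, where Lemma 4.1 arranges `Q` bounded; see the
module docstring for why the unbounded printed generality is not vendored) and `k ≥ 1`: with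
`P = conv(x_1,…,x_v) ⊆ Q = {y : a_jᵀy ≤ b_j}`, `S_{P,Q}` has a psd factorization of size `k` iff there
is a set `C` with `P ⊆ C ⊆ Q` admitting a psd lift of size `k`.
[cite: FawziEtAl2015, Thm. 3.3 (p09–p10)] -/
def FawziEtAl2015_thm33_pair : Prop :=
  ∀ (n v f k : ℕ) (x : Fin v → (Fin n → ℝ)) (a : Fin f → (Fin n → ℝ)) (b : Fin f → ℝ), 1 ≤ k →
    (∀ i j, a j ⬝ᵥ x i ≤ b j) →
    Bornology.IsBounded {y : Fin n → ℝ | ∀ j, a j ⬝ᵥ y ≤ b j} →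
    (interior {y : Fin n → ℝ | ∀ j, a j ⬝ᵥ y ≤ b j}).Nonempty →
      (HasPsdFactorization (pairSlackMatrix x a b) k ↔
        ∃ C : Set (Fin n → ℝ), convexHull ℝ (Set.range x) ⊆ C ∧ C ⊆ {y | ∀ j, a j ⬝ᵥ y ≤ b j} ∧
          HasPsdLift C k)

/-! ### Remark 3.4 / Lemma 4.1: every nonnegative matrix is the slack matrix of a pair of polytopes -/

/-- **FGPRT Lemma 4.1** (Gillis–Glineur; p13, verbatim): "Let `M ∈ ℝ^{p×q}_+` be a nonnegative matrix and
assume that `M𝟙 = 𝟙`. Let `r = rank M`. Then there exist polytopes `P, Q` in `ℝ^{r−1}` (where `P` and `Q`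
are bounded) such that `P ⊂ Q` and such that `M` is the slack matrix of the pair `P,Q`" (Remark 3.4:
hence "any nonnegative matrix `M` is the slack matrix of some pair of polytopes `P,Q`" after row
scaling, which does not change any of the ranks). Typed: such `M` equals `S_{P,Q}` for some points
`x_i ∈ ℝ^{r−1}` and an inequality description `(a_j, b_j)_{j<q}` of a bounded `Q` containing the `x_i`.
[cite: FawziEtAl2015, Lemma 4.1 (p13)] -/
def FawziEtAl2015_lemma41 : Prop :=
  ∀ (p q : ℕ) (M : Matrix (Fin p) (Fin q) ℝ), (∀ i j, 0 ≤ M i j) → (∀ i, ∑ j, M i j = 1) →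
    ∃ (x : Fin p → (Fin (M.rank - 1) → ℝ)) (a : Fin q → (Fin (M.rank - 1) → ℝ)) (b : Fin q → ℝ),
      (∀ i j, M i j = pairSlackMatrix x a b i j) ∧ (∀ i j, a j ⬝ᵥ x i ≤ b j) ∧
      Bornology.IsBounded {y : Fin (M.rank - 1) → ℝ | ∀ j, a j ⬝ᵥ y ≤ b j}

/-! ### §4: psd rank two via sandwiched ellipses -/

/-- **FGPRT §4** (p13, verbatim): "Assume that `rank M = 3` and let `P ⊂ Q ⊂ ℝ²` be two polytopes in the
plane such that `M` is the slack matrix of `P` with respect to `Q`. From [GRT13], we know that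
`rank_psd M = 2` if, and only if, there exists an ellipse `E` such that `P ⊂ E ⊂ Q`" (decidable by the
semidefinite program (1)–(3) there, using the S-lemma = the tree's `Literature.Analysis.Convexity.sLemma`).
Typed: for `x_i ∈ ℝ²` inside a bounded `Q = {y : a_jᵀ y ≤ b_j}` with `rank S_{P,Q} = 3`, `S_{P,Q}` has a psd
factorization of size `2` iff there are `A ≻ 0`, `c`, `γ` with `x_iᵀ A x_i + 2cᵀx_i + γ ≤ 0` for all `i`
and `{y : yᵀAy + 2cᵀy + γ ≤ 0} ⊆ Q`. [cite: FawziEtAl2015, §4 (p13)] -/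
def FawziEtAl2015_sec4_ellipse : Prop :=
  ∀ (v f : ℕ) (x : Fin v → (Fin 2 → ℝ)) (a : Fin f → (Fin 2 → ℝ)) (b : Fin f → ℝ),
    (∀ i j, a j ⬝ᵥ x i ≤ b j) → Bornology.IsBounded {y : Fin 2 → ℝ | ∀ j, a j ⬝ᵥ y ≤ b j} →
    (Matrix.of (pairSlackMatrix x a b)).rank = 3 →
      (HasPsdFactorization (pairSlackMatrix x a b) 2 ↔
        ∃ (A : Matrix (Fin 2) (Fin 2) ℝ) (c : Fin 2 → ℝ) (γ : ℝ), A.PosDef ∧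
          (∀ i, x i ⬝ᵥ (A *ᵥ x i) + 2 * (c ⬝ᵥ x i) + γ ≤ 0) ∧
          ∀ y : Fin 2 → ℝ, y ⬝ᵥ (A *ᵥ y) + 2 * (c ⬝ᵥ y) + γ ≤ 0 → ∀ j, a j ⬝ᵥ y ≤ b j)

/-! ### Proposition 3.8: psd rank and quantum correlation generation -/

/-- **FGPRT Proposition 3.8** (Jain–Shi–Wei–Zhang 2013; p11, verbatim): "Let `M` be a `p × q` nonnegative
matrix where all the entries sum up to one. Let `k ≥ 1`. Then the following are equivalent: (i) `M`
admits a psd factorization of size `k` … (ii) There is a quantum protocol for the correlation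
generation problem using `log k` qubits, i.e., `M` admits a factorization of the form (7) of size `k`":
`M_{ij} = Tr((F_i ⊗ G_j) ρ)` with POVMs `F_i, G_j ∈ S^k_+`, `Σ_i F_i = Σ_j G_j = I_k`, and a state
`ρ ∈ S^{k²}_+`, `Tr ρ = 1` (the survey works with real symmetric matrices throughout, p11).
[cite: FawziEtAl2015, Prop. 3.8 (p11–p12)] -/
def FawziEtAl2015_prop38 : Prop :=
  ∀ (p q k : ℕ) (M : Fin p → Fin q → ℝ), (∀ i j, 0 ≤ M i j) → ∑ i, ∑ j, M i j = 1 → 1 ≤ k →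
    (HasPsdFactorization M k ↔
      ∃ (F : Fin p → Matrix (Fin k) (Fin k) ℝ) (G : Fin q → Matrix (Fin k) (Fin k) ℝ)
        (ρ : Matrix (Fin k × Fin k) (Fin k × Fin k) ℝ),
        (∀ i, (F i).PosSemidef) ∧ ∑ i, F i = 1 ∧ (∀ j, (G j).PosSemidef) ∧ ∑ j, G j = 1 ∧
        ρ.PosSemidef ∧ ρ.trace = 1 ∧ ∀ i j, M i j = ((F i ⊗ₖ G j) * ρ).trace)

/-! ### Proposition 5.12: degree of convex sets with small psd lifts -/

/-- **FGPRT Proposition 5.12** (Gouveia–Parrilo–Thomas; p16, verbatim): "If `C ⊆ ℝⁿ` is a full-dimensional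
convex semialgebraic set with a `S^k_+`-lift, then the degree of `C` is at most `k^{O(k²n)}`", where "the
degree of `C` [is] the minimal degree of a (nonzero) polynomial whose zero set is the Zariski closure
of the boundary of `C`" (such a polynomial vanishes on the boundary; Renegar's quantifier
elimination, Theorems 5.10–5.11). Typed with the unprinted `O`-constant as `∃ c > 0` and the conclusion
in the form used downstream (Cor. 5.13): some nonzero polynomial of total degree `≤ k^{c k² n}` vanishes
on the boundary of `C`. (Semialgebraicity is automatic for sets with psd lifts:
`HasPsdLift.isSemialgebraic` in `PsdLiftAlgebraicBoundary.lean`, where this fact is PROVED modulo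
Renegar's Theorem 5.11 — `FawziEtAl2015_prop512_of_qe` — and its qualitative form is proved outright.)
[cite: FawziEtAl2015, Prop. 5.12 (p16)] -/
def FawziEtAl2015_prop512 : Prop :=
  ∃ c : ℝ, 0 < c ∧ ∀ (n k : ℕ) (C : Set (Fin n → ℝ)), Convex ℝ C → (interior C).Nonempty →
    HasPsdLift C k →
      ∃ P : MvPolynomial (Fin n) ℝ, P ≠ 0 ∧ (∀ y ∈ frontier C, MvPolynomial.eval y P = 0) ∧
        (P.totalDegree : ℝ) ≤ (k : ℝ) ^ (c * (k : ℝ) ^ 2 * n)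

/-! ### Discharge of `FawziEtAl2015_prop38`: psd factorizations and quantum correlation protocols -/

section Prop38

variable {k : ℕ}

/-- The Kronecker product of real psd matrices is psd (`(XᵀX) ⊗ (YᵀY) = (X ⊗ Y)ᵀ(X ⊗ Y)`). [folklore] -/
private theorem posSemidef_kronecker' {p q : Type*} [Fintype p] [Fintype q] [DecidableEq p]
    [DecidableEq q] {A : Matrix p p ℝ} {B : Matrix q q ℝ} (hA : A.PosSemidef) (hB : B.PosSemidef) :
    (A ⊗ₖ B).PosSemidef := by
  obtain ⟨X, rfl⟩ := CStarAlgebra.nonneg_iff_eq_star_mul_self.mp hA.nonneg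
  obtain ⟨Y, rfl⟩ := CStarAlgebra.nonneg_iff_eq_star_mul_self.mp hB.nonneg
  rw [mul_kronecker_mul, star_eq_conjTranspose, star_eq_conjTranspose, ← conjTranspose_kronecker]
  exact posSemidef_conjTranspose_mul_self _

/-- `Tr((F ⊗ G) ρ)` as a fourfold sum. [cite: FawziEtAl2015, Prop. 3.8 proof (p11–p12)] -/
private theorem trace_kronecker_mul_eq_sum (F G : Matrix (Fin k) (Fin k) ℝ)
    (ρ : Matrix (Fin k × Fin k) (Fin k × Fin k) ℝ) :
    ((F ⊗ₖ G) * ρ).trace = ∑ u, ∑ s, ∑ v, ∑ t, F u v * G s t * ρ (v, t) (u, s) := by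
  simp only [Matrix.trace, Matrix.diag_apply, Matrix.mul_apply, Matrix.kroneckerMap_apply,
    Fintype.sum_prod_type]

/-- **(ii) ⇒ (i), the reduced row factor**: for `F ⪰ 0` and a bipartite `ρ ⪰ 0`, the matrix
`A_{ts} = Σ_{u,v} F_{uv} ρ_{(v,t),(u,s)}` (the partial trace `Tr_1((F ⊗ I)ρ)`) satisfies
`Tr((F ⊗ G)ρ) = Tr(A G)` for every `G`. (The printed proof treats `ρ = ψψᵀ`, `ψ = Σ_s v_s ⊗ w_s`,
`A_i = VᵀF_iV`; the partial trace does the general case at once.)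
[cite: FawziEtAl2015, Prop. 3.8 proof, (ii) ⇒ (i) (p11–p12)] -/
private theorem trace_kronecker_mul_eq_trace_ptrace (F G : Matrix (Fin k) (Fin k) ℝ)
    (ρ : Matrix (Fin k × Fin k) (Fin k × Fin k) ℝ) :
    ((F ⊗ₖ G) * ρ).trace =
      ((Matrix.of fun t s => ∑ u, ∑ v, F u v * ρ (v, t) (u, s)) * G).trace := by
  rw [trace_kronecker_mul_eq_sum]
  have hR : ((Matrix.of fun t s => ∑ u, ∑ v, F u v * ρ (v, t) (u, s)) * G).trace =
      ∑ t, ∑ s, ∑ u, ∑ v, F u v * G s t * ρ (v, t) (u, s) := by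
    simp only [Matrix.trace, Matrix.diag_apply, Matrix.mul_apply, Matrix.of_apply, Finset.sum_mul]
    exact sum_congr rfl fun t _ => sum_congr rfl fun s _ => sum_congr rfl fun u _ =>
      sum_congr rfl fun v _ => by ring
  rw [hR]
  symm
  calc ∑ t, ∑ s, ∑ u, ∑ v, F u v * G s t * ρ (v, t) (u, s)
      = ∑ s, ∑ t, ∑ u, ∑ v, F u v * G s t * ρ (v, t) (u, s) := Finset.sum_comm
    _ = ∑ s, ∑ u, ∑ v, ∑ t, F u v * G s t * ρ (v, t) (u, s) := by
        refine sum_congr rfl fun s _ => ?_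
        rw [Finset.sum_comm]
        exact sum_congr rfl fun u _ => Finset.sum_comm
    _ = ∑ u, ∑ s, ∑ v, ∑ t, F u v * G s t * ρ (v, t) (u, s) := Finset.sum_comm

/-- The partial trace of `(F ⊗ I)ρ` is psd for `F, ρ ⪰ 0`: symmetric by the symmetry of `F` and `ρ`,
and `xᵀ A x = Tr((F ⊗ xxᵀ) ρ) ≥ 0`. [cite: FawziEtAl2015, Prop. 3.8 proof, (ii) ⇒ (i) (p11–p12)] -/
private theorem posSemidef_ptrace {F : Matrix (Fin k) (Fin k) ℝ}
    {ρ : Matrix (Fin k × Fin k) (Fin k × Fin k) ℝ} (hF : F.PosSemidef) (hρ : ρ.PosSemidef) :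
    (Matrix.of fun t s => ∑ u, ∑ v, F u v * ρ (v, t) (u, s)).PosSemidef := by
  classical
  have hFs : ∀ u v, F v u = F u v := fun u v => by simpa using hF.1.apply u v
  have hρs : ∀ x y, ρ y x = ρ x y := fun x y => by simpa using hρ.1.apply x y
  refine posSemidef_iff_dotProduct_mulVec.mpr ⟨?_, fun x => ?_⟩
  · refine Matrix.IsHermitian.ext fun t s => ?_
    simp only [star_trivial, Matrix.of_apply]
    rw [Finset.sum_comm]
    exact sum_congr rfl fun u _ => sum_congr rfl fun v _ => by rw [hFs v u, hρs (v, t) (u, s)]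
  · have hq : star x ⬝ᵥ ((Matrix.of fun t s => ∑ u, ∑ v, F u v * ρ (v, t) (u, s)) *ᵥ x) =
        ((Matrix.of fun t s => ∑ u, ∑ v, F u v * ρ (v, t) (u, s)) * vecMulVec x x).trace := by
      simp only [star_trivial, dotProduct, mulVec, Matrix.trace, Matrix.diag_apply, Matrix.mul_apply,
        vecMulVec_apply, Matrix.of_apply, Finset.mul_sum]
      exact sum_congr rfl fun t _ => sum_congr rfl fun s _ => by ring
    rw [hq, ← trace_kronecker_mul_eq_trace_ptrace]
    exact trace_mul_nonneg (posSemidef_kronecker' hF (by simpa using posSemidef_vecMulVec_self_star x)) hρ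

/-- **FGPRT Proposition 3.8, (ii) ⇒ (i)** (p11–p12), for factors of any finite index types: a
factorization `M_{ij} = Tr((F_i ⊗ G_j)ρ)` with `F_i, G_j ⪰ 0` of size `k` and `ρ ⪰ 0` (no
normalisation needed) gives a psd factorization of size `k`, `A_i = Tr_1((F_i ⊗ I)ρ)`, `B_j = G_j`.
[cite: FawziEtAl2015, Prop. 3.8 (p11–p12)] -/
theorem HasPsdFactorization.of_kronecker_trace {ι κ : Type*} {M : ι → κ → ℝ}
    (F : ι → Matrix (Fin k) (Fin k) ℝ) (G : κ → Matrix (Fin k) (Fin k) ℝ)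
    (ρ : Matrix (Fin k × Fin k) (Fin k × Fin k) ℝ) (hF : ∀ i, (F i).PosSemidef)
    (hG : ∀ j, (G j).PosSemidef) (hρ : ρ.PosSemidef) (hM : ∀ i j, M i j = ((F i ⊗ₖ G j) * ρ).trace) :
    HasPsdFactorization M k :=
  ⟨fun i => Matrix.of fun t s => ∑ u, ∑ v, F i u v * ρ (v, t) (u, s), G,
    fun i => posSemidef_ptrace (hF i) hρ, hG, fun i j => by
      rw [hM, trace_kronecker_mul_eq_trace_ptrace]⟩

/-- `Tr((F ⊗ G) · vec(X)vec(X)ᵀ) = Tr(F X G Xᵀ)` for symmetric `F` ("`Tr(AB) = eᵀ(A ⊗ B)e`,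
`e = vec(I_k)`", p12, transported by `X`). [cite: FawziEtAl2015, Prop. 3.8 proof, (i) ⇒ (ii) (p12)] -/
private theorem trace_kronecker_mul_vecMulVec (F G X : Matrix (Fin k) (Fin k) ℝ) (hF : Fᵀ = F) :
    ((F ⊗ₖ G) * vecMulVec (fun x : Fin k × Fin k => X x.1 x.2) (fun x => X x.1 x.2)).trace =
      (F * X * G * Xᵀ).trace := by
  rw [trace_kronecker_mul_eq_sum]
  have hR : (F * X * G * Xᵀ).trace = ∑ u, ∑ s, ∑ v, ∑ t, F v u * X u s * G s t * X v t := by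
    simp only [Matrix.trace, Matrix.diag_apply, Matrix.mul_apply, transpose_apply, Finset.sum_mul]
    -- `Σ_v Σ_t (Σ_s (Σ_u F v u X u s) G s t) X v t`
    calc ∑ v, ∑ t, ∑ s, ∑ u, F v u * X u s * G s t * X v t
        = ∑ v, ∑ s, ∑ t, ∑ u, F v u * X u s * G s t * X v t :=
          sum_congr rfl fun v _ => Finset.sum_comm
      _ = ∑ v, ∑ s, ∑ u, ∑ t, F v u * X u s * G s t * X v t :=
          sum_congr rfl fun v _ => sum_congr rfl fun s _ => Finset.sum_comm
      _ = ∑ v, ∑ u, ∑ s, ∑ t, F v u * X u s * G s t * X v t :=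
          sum_congr rfl fun v _ => Finset.sum_comm
      _ = ∑ u, ∑ v, ∑ s, ∑ t, F v u * X u s * G s t * X v t := Finset.sum_comm
      _ = ∑ u, ∑ s, ∑ v, ∑ t, F v u * X u s * G s t * X v t :=
          sum_congr rfl fun u _ => Finset.sum_comm
  rw [hR]
  refine sum_congr rfl fun u _ => sum_congr rfl fun s _ => sum_congr rfl fun v _ =>
    sum_congr rfl fun t _ => ?_
  have hF' : F v u = F u v := by rw [← transpose_apply F u v, hF]
  simp only [vecMulVec_apply, hF']
  ring

/-- **FGPRT Proposition 3.8, (i) ⇒ (ii)** (p12), given the congruence normalisations `A_i = Rᵀ F_i R`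
(`Σ F_i = I`) and `B_j = Sᵀ G_j S` (`Σ G_j = I`) of the two psd families: with `X = R Sᵀ` and the pure
state `ρ = vec(X) vec(X)ᵀ`, `Tr((F_i ⊗ G_j)ρ) = Tr(F_i X G_j Xᵀ) = Tr(A_i B_j) = M_{ij}` and
`Tr ρ = Tr(X Xᵀ) = Σ_{ij} M_{ij} = 1` (the printed `ψ = (Σ_A^{1/2} ⊗ Σ_B^{1/2}) e`, up to the choice
of square roots). [cite: FawziEtAl2015, Prop. 3.8 proof, (i) ⇒ (ii) (p12)] -/
private theorem exists_quantumProtocol_of_congr {ι κ : Type*} [Fintype ι] [Fintype κ]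
    {M : ι → κ → ℝ} (hsum : ∑ i, ∑ j, M i j = 1)
    (R S : Matrix (Fin k) (Fin k) ℝ) (F : ι → Matrix (Fin k) (Fin k) ℝ)
    (G : κ → Matrix (Fin k) (Fin k) ℝ) (hF : ∀ i, (F i).PosSemidef) (hFs : ∑ i, F i = 1)
    (hGs : ∑ j, G j = 1) (hM : ∀ i j, M i j = (Rᵀ * F i * R * (Sᵀ * G j * S)).trace) :
    ∃ ρ : Matrix (Fin k × Fin k) (Fin k × Fin k) ℝ, ρ.PosSemidef ∧ ρ.trace = 1 ∧
      ∀ i j, M i j = ((F i ⊗ₖ G j) * ρ).trace := by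
  have hFt : ∀ i, (F i)ᵀ = F i := fun i => by
    simpa [conjTranspose_eq_transpose_of_trivial] using (hF i).1.eq
  set X : Matrix (Fin k) (Fin k) ℝ := R * Sᵀ with hX
  have hM' : ∀ i j, M i j = (F i * X * G j * Xᵀ).trace := fun i j => by
    rw [hM i j, hX, transpose_mul, transpose_transpose]
    calc (Rᵀ * F i * R * (Sᵀ * G j * S)).trace = (Rᵀ * (F i * R * Sᵀ * G j * S)).trace := by
          simp only [Matrix.mul_assoc]
      _ = (F i * R * Sᵀ * G j * S * Rᵀ).trace := Matrix.trace_mul_comm _ _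
      _ = (F i * (R * Sᵀ) * G j * (S * Rᵀ)).trace := by simp only [Matrix.mul_assoc]
  refine ⟨vecMulVec (fun x : Fin k × Fin k => X x.1 x.2) (fun x => X x.1 x.2),
    by simpa using posSemidef_vecMulVec_self_star (fun x : Fin k × Fin k => X x.1 x.2), ?_,
    fun i j => by rw [hM' i j, trace_kronecker_mul_vecMulVec _ _ _ (hFt i)]⟩
  -- `Tr ρ = Σ_{ab} X_{ab}² = Tr(X Xᵀ) = Tr((Σ F_i) X (Σ G_j) Xᵀ) = Σ_{ij} M_{ij} = 1`
  have h1 : (vecMulVec (fun x : Fin k × Fin k => X x.1 x.2) (fun x => X x.1 x.2)).trace =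
      (X * Xᵀ).trace := by
    rw [trace_vecMulVec]
    simp only [dotProduct, Fintype.sum_prod_type, Matrix.trace, Matrix.diag_apply, Matrix.mul_apply,
      transpose_apply]
  have h2 : ∑ i, ∑ j, M i j = ((∑ i, F i) * X * (∑ j, G j) * Xᵀ).trace := by
    simp only [hM', Matrix.sum_mul, Matrix.mul_sum, trace_sum]
    exact Finset.sum_comm
  rw [h1, ← hsum, h2, hFs, hGs, Matrix.one_mul, Matrix.mul_one]

/-- **Discharge of `FawziEtAl2015_prop38`** (Proposition 3.8, Jain–Shi–Wei–Zhang: a psd factorization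
of size `k` ⇔ a correlation-generation protocol `M_{ij} = Tr((F_i ⊗ G_j)ρ)` with POVMs of size `k` and a
bipartite state): (ii) ⇒ (i) by the partial trace (`HasPsdFactorization.of_kronecker_trace`); (i) ⇒ (ii)
by normalising both psd families by congruence (`exists_posSemidef_sum_eq_one_congr`, the printed
`Σ_A^{-1/2}·Σ_A^{-1/2}` step; `p, q ≥ 1` because the entries sum to one) and the pure state
`vec(X)vec(X)ᵀ`, `X = R Sᵀ`. [cite: FawziEtAl2015, Prop. 3.8 (p11–p12)] -/
theorem FawziEtAl2015_prop38_holds : FawziEtAl2015_prop38 := by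
  intro p q k M _hM hsum _hk
  classical
  constructor
  · rintro ⟨A, B, hA, hB, hM⟩
    -- `p, q ≥ 1` since the entries sum to one
    have hp : Nonempty (Fin p) := by
      rcases Nat.eq_zero_or_pos p with h | h
      · subst h
        simp at hsum
      · exact ⟨⟨0, h⟩⟩
    have hq : Nonempty (Fin q) := by
      rcases Nat.eq_zero_or_pos q with h | h
      · subst h
        simp at hsum
      · exact ⟨⟨0, h⟩⟩
    obtain ⟨R, F, hF, hFs, hAF⟩ := exists_posSemidef_sum_eq_one_congr A hA
    obtain ⟨S, G, hG, hGs, hBG⟩ := exists_posSemidef_sum_eq_one_congr B hB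
    obtain ⟨ρ, hρ, hρ1, hMρ⟩ := exists_quantumProtocol_of_congr hsum R S F G hF hFs hGs
      (fun i j => by rw [hM, hAF, hBG])
    exact ⟨F, G, ρ, hF, hFs, hG, hGs, hρ, hρ1, hMρ⟩
  · rintro ⟨F, G, ρ, hF, -, hG, -, hρ, -, hM⟩
    exact HasPsdFactorization.of_kronecker_trace F G ρ hF hG hρ hM

end Prop38

/-! ### Discharge of `FawziEtAl2015_lemma41`: every row-stochastic nonnegative matrix is `S_{P,Q}` -/

section Lemma41

/-- **Discharge of `FawziEtAl2015_lemma41`** (Lemma 4.1, Gillis–Glineur: a nonnegative `M` with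
`M𝟙 = 𝟙` and `rank M = r` is the slack matrix of a pair of bounded polytopes `P ⊆ Q ⊂ ℝ^{r−1}`). The
printed proof takes a rank factorization `M = AB` with `A𝟙 = 𝟙`, `B𝟙 = 𝟙` and reads off `P =
conv(a_i)`, `Q = {x : Σ x_i b_i + (1 − Σ x_i) b_r ≥ 0}`; here the same affine parametrisation of the
row space is produced intrinsically: the rows `m_i` lie in the affine subspace `m_{i₀} + U`,
`U = span{m_i − m_{i₀}}` of dimension `r − 1` inside the hyperplane `{Σ_j z_j = 0}`; in an ORTHONORMAL
basis `d_1,…,d_{r−1}` of `U`, `m_i = m_{i₀} + Σ_l x_{il} d_l`, so `M_{ij} = b_j − a_jᵀx_i` with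
`b_j = (m_{i₀})_j`, `a_j = −(d_l)_j)_l`, and `Q = {y : m_{i₀} + Σ_l y_l d_l ≥ 0}`. Boundedness of `Q` (the
printed recession-direction argument "`w ≥ 0`, `𝟙ᵀw = 0` ⇒ `w = 0` ⇒ `z = 0`") becomes: a point of `Q`
has coordinates `z = m_{i₀} + Σ y_l d_l ≥ 0` summing to `1`, so `‖y‖₂² = ‖z − m_{i₀}‖₂² ≤ q`.
[cite: FawziEtAl2015, Lemma 4.1 (p13)] -/
theorem FawziEtAl2015_lemma41_holds : FawziEtAl2015_lemma41 := by
  intro p q M hM hrow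
  classical
  rcases Nat.eq_zero_or_pos p with hp | hp
  · -- no rows: `rank M = 0`, everything lives in `ℝ⁰`
    subst hp
    have hr : M.rank = 0 := Nat.le_zero.mp (Matrix.rank_le_height M)
    have hempty : IsEmpty (Fin (M.rank - 1)) := by
      rw [hr]
      exact (inferInstance : IsEmpty (Fin 0))
    refine ⟨fun i => Fin.elim0 i, fun _ _ => 0, fun _ => 0, fun i => Fin.elim0 i, fun i => Fin.elim0 i,
      ?_⟩
    exact (Set.toFinite _).isBounded
  -- `p ≥ 1`: a base row `i₀`
  set i₀ : Fin p := ⟨0, hp⟩ with hi₀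
  -- the rows as Euclidean vectors and the direction space `U = span{m_i − m_{i₀}}`
  let m : Fin p → EuclideanSpace ℝ (Fin q) := fun i => WithLp.toLp 2 (M i)
  have hm : ∀ i j, m i j = M i j := fun i j => rfl
  let U : Submodule ℝ (EuclideanSpace ℝ (Fin q)) := Submodule.span ℝ (Set.range fun i => m i - m i₀)
  have hmemU : ∀ i, m i - m i₀ ∈ U := fun i => Submodule.subset_span ⟨i, rfl⟩
  have hσm : ∀ i, ∑ j, m i j = 1 := fun i => by simp only [hm]; exact hrow i
  have hσU : ∀ v ∈ U, ∑ j, v j = 0 := by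
    intro v hv
    induction hv using Submodule.span_induction with
    | mem v hv =>
      obtain ⟨i, rfl⟩ := hv
      simp [Finset.sum_sub_distrib, hσm]
    | zero => simp
    | add v w _ _ hv hw => simp [Finset.sum_add_distrib, hv, hw]
    | smul c v _ hv => simp [← Finset.mul_sum, hv]
  -- `dim U = rank M − 1`: `span(rows) = U ⊕ ℝ m_{i₀}`
  have hfinU : Module.finrank ℝ U = M.rank - 1 := by
    have hm0 : m i₀ ≠ 0 := by
      intro h
      have h1 := hσm i₀
      rw [h] at h1
      simp at h1
    have hL : Module.finrank ℝ (Submodule.span ℝ {m i₀}) = 1 := finrank_span_singleton hm0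
    have hW : Module.finrank ℝ (Submodule.span ℝ (Set.range m)) = M.rank := by
      let e : (Fin q → ℝ) ≃ₗ[ℝ] EuclideanSpace ℝ (Fin q) := (WithLp.linearEquiv 2 ℝ (Fin q → ℝ)).symm
      have hWmap : Submodule.span ℝ (Set.range m) =
          (Submodule.span ℝ (Set.range M.row)).map (e : (Fin q → ℝ) →ₗ[ℝ] EuclideanSpace ℝ (Fin q)) := by
        rw [Submodule.map_span, ← Set.range_comp]
        rfl
      rw [hWmap, LinearEquiv.finrank_map_eq, ← Matrix.rank_eq_finrank_span_row]
    have hsup : U ⊔ Submodule.span ℝ {m i₀} = Submodule.span ℝ (Set.range m) := by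
      apply le_antisymm
      · refine sup_le (Submodule.span_le.mpr ?_) (Submodule.span_le.mpr ?_)
        · rintro _ ⟨i, rfl⟩
          exact (Submodule.span ℝ (Set.range m)).sub_mem (Submodule.subset_span ⟨i, rfl⟩)
            (Submodule.subset_span ⟨i₀, rfl⟩)
        · intro v hv
          rw [Set.mem_singleton_iff] at hv
          subst hv
          exact Submodule.subset_span ⟨i₀, rfl⟩
      · refine Submodule.span_le.mpr ?_
        rintro _ ⟨i, rfl⟩
        have h : m i = (m i - m i₀) + m i₀ := (sub_add_cancel (m i) (m i₀)).symm
        rw [h]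
        exact Submodule.add_mem _ (Submodule.mem_sup_left (hmemU i))
          (Submodule.mem_sup_right (Submodule.subset_span rfl))
    have hinf : U ⊓ Submodule.span ℝ {m i₀} = ⊥ := by
      rw [eq_bot_iff]
      intro v hv
      rw [Submodule.mem_bot]
      obtain ⟨hvU, hvL⟩ := Submodule.mem_inf.mp hv
      rw [Submodule.mem_span_singleton] at hvL
      obtain ⟨c, rfl⟩ := hvL
      have h0 := hσU _ hvU
      have h1 : ∑ j, (c • m i₀) j = c * ∑ j, m i₀ j := by
        rw [Finset.mul_sum]
        exact sum_congr rfl fun j _ => by simp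
      rw [h1, hσm, mul_one] at h0
      rw [h0, zero_smul]
    have hdim := Submodule.finrank_sup_add_finrank_inf_eq U (Submodule.span ℝ {m i₀})
    rw [hsup, hinf, finrank_bot, hW, hL] at hdim
    omega
  -- an orthonormal basis `d` of `U` indexed by `Fin (rank M − 1)` and the coordinates `x_i`
  let bU : OrthonormalBasis (Fin (M.rank - 1)) ℝ U := (stdOrthonormalBasis ℝ U).reindex (finCongr hfinU)
  let d : Fin (M.rank - 1) → EuclideanSpace ℝ (Fin q) := fun l => (bU l : EuclideanSpace ℝ (Fin q))
  have hdU : ∀ l, d l ∈ U := fun l => (bU l).2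
  have hdorth : ∀ l l', ∑ j, d l j * d l' j = if l = l' then 1 else 0 := by
    intro l l'
    have h := orthonormal_iff_ite.mp bU.orthonormal l l'
    rw [Submodule.coe_inner] at h
    simpa [PiLp.inner_apply, mul_comm] using h
  let x : Fin p → Fin (M.rank - 1) → ℝ := fun i l => bU.repr ⟨m i - m i₀, hmemU i⟩ l
  have hx : ∀ i j, M i j = M i₀ j + ∑ l, x i l * d l j := by
    intro i j
    have h := bU.sum_repr ⟨m i - m i₀, hmemU i⟩
    have h2 := congrArg (fun w : U => (w : EuclideanSpace ℝ (Fin q)) j) h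
    simp only [Submodule.coe_sum, Submodule.coe_smul] at h2
    have h3 : ∑ l, x i l * d l j = M i j - M i₀ j := by
      simpa [WithLp.ofLp_sum, Finset.sum_apply, smul_eq_mul, hm] using h2
    linarith
  have hslack : ∀ i j, M i j = pairSlackMatrix x (fun j l => -d l j) (fun j => M i₀ j) i j := by
    intro i j
    rw [pairSlackMatrix_apply, hx i j]
    simp only [dotProduct, neg_mul, Finset.sum_neg_distrib, sub_neg_eq_add]
    exact congrArg _ (sum_congr rfl fun l _ => mul_comm _ _)
  refine ⟨x, fun j l => -d l j, fun j => M i₀ j, hslack, fun i j => ?_, ?_⟩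
  · have h := hslack i j
    rw [pairSlackMatrix_apply] at h
    linarith [hM i j]
  · -- `Q` is bounded: its points have coordinates `z = m_{i₀} + Σ y_l d_l ∈ [0,1]^q`
    rw [isBounded_iff_forall_norm_le]
    refine ⟨Real.sqrt q, fun y hy => ?_⟩
    simp only [Set.mem_setOf_eq, dotProduct, neg_mul, Finset.sum_neg_distrib] at hy
    have hz : ∀ j, 0 ≤ M i₀ j + ∑ l, d l j * y l := fun j => by linarith [hy j]
    have hzsum : ∑ j, (M i₀ j + ∑ l, d l j * y l) = 1 := by
      rw [Finset.sum_add_distrib, hrow i₀, Finset.sum_comm]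
      have h0 : ∀ l, ∑ j, d l j * y l = 0 := fun l => by
        rw [← Finset.sum_mul, hσU _ (hdU l), zero_mul]
      simp [h0]
    have hz1 : ∀ j, M i₀ j + ∑ l, d l j * y l ≤ 1 := fun j => by
      rw [← hzsum]
      exact Finset.single_le_sum (fun j _ => hz j) (mem_univ j)
    have hM1 : ∀ j, M i₀ j ≤ 1 := fun j => by
      rw [← hrow i₀]
      exact Finset.single_le_sum (fun j _ => hM i₀ j) (mem_univ j)
    have hw : ∀ j, (∑ l, d l j * y l) ^ 2 ≤ 1 := by
      intro j
      have habs : |∑ l, d l j * y l| ≤ 1 := by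
        rw [abs_le]
        constructor <;> linarith [hz j, hz1 j, hM i₀ j, hM1 j]
      have h := sq_le_one_iff_abs_le_one (∑ l, d l j * y l)
      exact h.mpr habs
    -- Parseval in the orthonormal basis: `Σ_l y_l² = Σ_j (Σ_l d_l(j) y_l)²`
    have hParseval : ∑ j, (∑ l, d l j * y l) ^ 2 = ∑ l, y l ^ 2 := by
      calc ∑ j, (∑ l, d l j * y l) ^ 2 = ∑ j, ∑ l, ∑ l', (d l j * y l) * (d l' j * y l') := by
              refine sum_congr rfl fun j _ => ?_
              rw [sq, Finset.sum_mul_sum]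
        _ = ∑ l, ∑ l', y l * y l' * ∑ j, d l j * d l' j := by
              rw [Finset.sum_comm]
              refine sum_congr rfl fun l _ => ?_
              rw [Finset.sum_comm]
              refine sum_congr rfl fun l' _ => ?_
              rw [Finset.mul_sum]
              exact sum_congr rfl fun j _ => by ring
        _ = ∑ l, y l ^ 2 := by
              simp only [hdorth, mul_ite, mul_one, mul_zero, Finset.sum_ite_eq, Finset.mem_univ, if_true,
                sq]
    have hsumsq : ∑ l, y l ^ 2 ≤ q := by
      rw [← hParseval]
      calc ∑ j, (∑ l, d l j * y l) ^ 2 ≤ ∑ _j : Fin q, (1 : ℝ) := Finset.sum_le_sum fun j _ => hw j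
        _ = q := by simp
    rw [pi_norm_le_iff_of_nonneg (Real.sqrt_nonneg _)]
    intro l
    rw [Real.norm_eq_abs, ← Real.sqrt_sq_eq_abs]
    apply Real.sqrt_le_sqrt
    calc y l ^ 2 ≤ ∑ l, y l ^ 2 := Finset.single_le_sum (fun l _ => sq_nonneg (y l)) (mem_univ l)
      _ ≤ q := hsumsq

end Lemma41

/-! ### Discharge of `FawziEtAl2015_thm33` and `FawziEtAl2015_thm33_pair`: psd lifts vs. psd factorizations -/

section Thm33

open Literature.Computation.Certificates.SemidefiniteComplementarity (frob IsPrimalFeasible)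
open Literature.Computation.Certificates.SDPFaceReduction (exists_posSemidef_certificate_of_lowerBound)
open Literature.Analysis.Convex (LPDuality.exists_dual_feasible_of_forall_le)

variable {k : ℕ}

/-! #### Linear functionals on matrices against the trace pairing -/

/-- Riesz for the trace pairing: every linear functional on `k × k` real matrices is `Y ↦ tr(G Y)`
(`G_{ab} = ℓ(E_{ba})`). [folklore] -/
private theorem exists_trace_repr (ℓ : Matrix (Fin k) (Fin k) ℝ →ₗ[ℝ] ℝ) :
    ∃ G : Matrix (Fin k) (Fin k) ℝ, ∀ Y, ℓ Y = (G * Y).trace := by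
  classical
  refine ⟨Matrix.of fun a b => ℓ (single b a 1), fun Y => ?_⟩
  conv_lhs => rw [matrix_eq_sum_single Y]
  simp only [map_sum]
  have hsingle : ∀ i j, ℓ (single i j (Y i j)) = Y i j * ℓ (single i j 1) := by
    intro i j
    rw [← smul_eq_mul, ← map_smul, smul_single, smul_eq_mul, mul_one]
  simp only [hsingle, trace, diag_apply, mul_apply, of_apply]
  rw [sum_comm]
  exact sum_congr rfl fun a _ => sum_congr rfl fun b _ => mul_comm _ _

/-- Symmetrised representative: on SYMMETRIC matrices `tr(G Y) = tr(½(G + Gᵀ) Y)`, and `½(G + Gᵀ)` is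
Hermitian. [folklore] -/
private theorem exists_isHermitian_trace_repr (ℓ : Matrix (Fin k) (Fin k) ℝ →ₗ[ℝ] ℝ) :
    ∃ G : Matrix (Fin k) (Fin k) ℝ, G.IsHermitian ∧ ∀ Y, Yᵀ = Y → ℓ Y = (G * Y).trace := by
  obtain ⟨G, hG⟩ := exists_trace_repr ℓ
  refine ⟨(2 : ℝ)⁻¹ • (G + Gᵀ), ?_, fun Y hY => ?_⟩
  · rw [IsHermitian, conjTranspose_eq_transpose_of_trivial, transpose_smul, transpose_add,
      transpose_transpose, add_comm]
  · have hT : (Gᵀ * Y).trace = (G * Y).trace := by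
      rw [← trace_transpose, transpose_mul, transpose_transpose, hY, trace_mul_comm]
    rw [hG, Matrix.smul_mul, Matrix.add_mul, trace_smul, trace_add, hT, smul_eq_mul]
    ring

/-- A real positive semidefinite matrix is symmetric. [folklore] -/
private theorem transpose_eq_of_posSemidef' {M : Matrix (Fin k) (Fin k) ℝ} (hM : M.PosSemidef) :
    Mᵀ = M := by
  have h := hM.1
  rwa [IsHermitian, conjTranspose_eq_transpose_of_trivial] at h

/-! #### Conic duality on a psd lift (facial reduction + Slater duality, from the tree) -/

/-- **Duality certificates on a spectrahedron `S^k_+ ∩ L`, no Slater point needed.** If a linear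
functional `g` is bounded above by `β` on the nonempty set `S^k_+ ∩ L` (`L` an affine subspace of
`k × k` matrices), then there are `U ⪰ 0` and `μ ≥ 0` with `β − g(M) = tr(U M) + μ` for every `M ⪰ 0`
in `L`. This is the "by Farkas' lemma there exists `B_j ∈ S^k_+`" step of the proof of Theorem 3.3 in
its correct Slater-free form (the identity holds on the feasible set, not on all of `L`, and carries a
constant `μ ≥ 0`): `L` is cut out by finitely many trace equations `tr(A_i M) = β_i` (coordinates of
`M mod L.direction`), and the tree's facial-reduction certificate
`SDPFaceReduction.exists_posSemidef_certificate_of_lowerBound` is applied to the standard-form program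
they define. [cite: FawziEtAl2015, Thm. 3.3 proof (p10, "By Farkas' lemma … there exists B_j ∈ S^k_+")]
[cite: BraunPokuttaZink2015, Thm. (SDP factorization)] -/
theorem exists_posSemidef_certificate_of_le_on_psdLift
    (L : AffineSubspace ℝ (Matrix (Fin k) (Fin k) ℝ)) (g : Matrix (Fin k) (Fin k) ℝ →ₗ[ℝ] ℝ) (β : ℝ)
    (hne : ∃ M : Matrix (Fin k) (Fin k) ℝ, M.PosSemidef ∧ M ∈ L)
    (hg : ∀ M : Matrix (Fin k) (Fin k) ℝ, M.PosSemidef → M ∈ L → g M ≤ β) :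
    ∃ U : Matrix (Fin k) (Fin k) ℝ, U.PosSemidef ∧ ∃ μ : ℝ, 0 ≤ μ ∧
      ∀ M : Matrix (Fin k) (Fin k) ℝ, M.PosSemidef → M ∈ L → β - g M = (U * M).trace + μ := by
  classical
  obtain ⟨M₁, hM₁, hM₁L⟩ := hne
  -- `L` is cut out by the coordinates of `M mod V`, `V = L.direction`, in a basis of the quotient
  set V : Submodule ℝ (Matrix (Fin k) (Fin k) ℝ) := L.direction with hV
  let bQ := Module.finBasis ℝ ((Matrix (Fin k) (Fin k) ℝ) ⧸ V)
  let ℓ : Fin (Module.finrank ℝ ((Matrix (Fin k) (Fin k) ℝ) ⧸ V)) →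
      (Matrix (Fin k) (Fin k) ℝ →ₗ[ℝ] ℝ) := fun i => (bQ.coord i).comp V.mkQ
  have hℓapply : ∀ i (M : Matrix (Fin k) (Fin k) ℝ), ℓ i M = bQ.repr (V.mkQ M) i := fun i M => rfl
  have hℓ : ∀ M : Matrix (Fin k) (Fin k) ℝ, M ∈ L ↔ ∀ i, ℓ i M = ℓ i M₁ := by
    intro M
    have hquot : V.mkQ M = V.mkQ M₁ ↔ M ∈ L := by
      rw [Submodule.mkQ_apply, Submodule.mkQ_apply, Submodule.Quotient.eq, ← vsub_eq_sub]
      exact AffineSubspace.vsub_right_mem_direction_iff_mem hM₁L M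
    rw [← hquot, bQ.ext_elem_iff]
    simp only [hℓapply]
  -- Hermitian representatives of the `ℓ i` and of `g`
  choose G hGh hG using fun i => exists_isHermitian_trace_repr (ℓ i)
  obtain ⟨Gg, hGgh, hGg⟩ := exists_isHermitian_trace_repr g
  -- the standard-form program `tr(G_i X) = ℓ_i(M₁), X ⪰ 0` has feasible set `S^k_+ ∩ L`
  have hfeas : ∀ X : Matrix (Fin k) (Fin k) ℝ,
      IsPrimalFeasible G (fun i => ℓ i M₁) X ↔ X.PosSemidef ∧ X ∈ L := by
    intro X
    constructor
    · rintro ⟨hX, hXi⟩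
      refine ⟨hX, (hℓ X).mpr fun i => ?_⟩
      rw [hG i X (transpose_eq_of_posSemidef' hX)]
      exact hXi i
    · rintro ⟨hX, hXL⟩
      refine ⟨hX, fun i => ?_⟩
      show (G i * X).trace = ℓ i M₁
      rw [← hG i X (transpose_eq_of_posSemidef' hX)]
      exact (hℓ X).mp hXL i
  have hne' : ∃ X, IsPrimalFeasible G (fun i => ℓ i M₁) X := ⟨M₁, (hfeas M₁).mpr ⟨hM₁, hM₁L⟩⟩
  have hp : ∀ X, IsPrimalFeasible G (fun i => ℓ i M₁) X → -β ≤ frob (-Gg) X := by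
    intro X hX
    obtain ⟨hXp, hXL⟩ := (hfeas X).mp hX
    show -β ≤ (-Gg * X).trace
    rw [Matrix.neg_mul, trace_neg, ← hGg X (transpose_eq_of_posSemidef' hXp)]
    linarith [hg X hXp hXL]
  obtain ⟨U, hU, μ, hμ, hcert⟩ := exists_posSemidef_certificate_of_lowerBound hGh hGgh.neg hne' hp
  refine ⟨U, hU, μ, hμ, fun M hM hML => ?_⟩
  have h := hcert M ((hfeas M).mpr ⟨hM, hML⟩)
  simp only [frob, Matrix.neg_mul, trace_neg] at h
  rw [← hGg M (transpose_eq_of_posSemidef' hM)] at h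
  linarith

/-! #### Bounded polyhedra: recession directions and dual multipliers -/

/-- A bounded set containing a ray `{y + t z : t ≥ 0}` has `z = 0`. [folklore] -/
private theorem eq_zero_of_ray_subset {n : ℕ} {Q : Set (Fin n → ℝ)} (hQ : Bornology.IsBounded Q)
    {y z : Fin n → ℝ} (h : ∀ t : ℝ, 0 ≤ t → y + t • z ∈ Q) : z = 0 := by
  obtain ⟨R, hR⟩ := isBounded_iff_forall_norm_le.mp hQ
  by_contra hz
  have hzn : 0 < ‖z‖ := norm_pos_iff.mpr hz
  have hy : ‖y‖ ≤ R := by simpa using hR _ (h 0 le_rfl)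
  set t : ℝ := (R + ‖y‖ + 1) / ‖z‖ with ht_def
  have ht : 0 ≤ t := div_nonneg (by linarith [norm_nonneg y]) hzn.le
  have hmem := hR _ (h t ht)
  have htz : t * ‖z‖ = R + ‖y‖ + 1 := div_mul_cancel₀ _ hzn.ne'
  have h1 : ‖t • z‖ ≤ ‖y + t • z‖ + ‖y‖ := by
    have := norm_sub_le (y + t • z) y
    rwa [add_sub_cancel_left] at this
  rw [norm_smul, Real.norm_of_nonneg ht] at h1
  linarith

/-- Linear functionals are bounded above on bounded subsets of `ℝⁿ`. [folklore] -/
private theorem exists_dotProduct_le_of_isBounded {n : ℕ} {Q : Set (Fin n → ℝ)}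
    (hQ : Bornology.IsBounded Q) (c : Fin n → ℝ) : ∃ δ : ℝ, ∀ y ∈ Q, c ⬝ᵥ y ≤ δ := by
  obtain ⟨R, hR⟩ := isBounded_iff_forall_norm_le.mp hQ
  refine ⟨(∑ i, |c i|) * R, fun y hy => ?_⟩
  have hyR := hR y hy
  calc c ⬝ᵥ y = ∑ i, c i * y i := rfl
    _ ≤ ∑ i, |c i| * R := sum_le_sum fun i _ => by
        have h1 : c i * y i ≤ |c i| * |y i| := by
          rw [← abs_mul]
          exact le_abs_self _
        have h2 : |y i| ≤ R := by
          have := norm_le_pi_norm y i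
          rw [Real.norm_eq_abs] at this
          exact this.trans hyR
        nlinarith [abs_nonneg (c i)]
    _ = (∑ i, |c i|) * R := by rw [Finset.sum_mul]

/-- **Dual multipliers from boundedness** (Schrijver Cor. 7.1h, first paragraph): for a nonempty BOUNDED
polyhedron `Q = {y : a_jᵀy ≤ b_j}`, every vector `c` is a nonnegative combination `Σ_j λ_j a_j` of the
constraint normals (the LP `max cᵀy` over `Q` is bounded, hence dual feasible).
[cite: Schrijver1986, Cor 7.1h proof (p. 93)] -/
private theorem exists_nonneg_vecMul_eq_of_isBounded {n f : ℕ} (a : Fin f → (Fin n → ℝ))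
    (b : Fin f → ℝ) (hne : ∃ y : Fin n → ℝ, ∀ j, a j ⬝ᵥ y ≤ b j)
    (hQ : Bornology.IsBounded {y : Fin n → ℝ | ∀ j, a j ⬝ᵥ y ≤ b j}) (c : Fin n → ℝ) :
    ∃ lam : Fin f → ℝ, 0 ≤ lam ∧ lam ᵥ* Matrix.of a = c := by
  obtain ⟨δ, hδ⟩ := exists_dotProduct_le_of_isBounded hQ c
  refine LPDuality.exists_dual_feasible_of_forall_le (Matrix.of a) b c (δ := δ) ?_ ?_
  · obtain ⟨y, hy⟩ := hne
    exact ⟨y, fun j => hy j⟩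
  · intro y hy
    exact hδ y fun j => hy j

/-- The set of positive semidefinite matrices in an affine subspace is convex. [folklore] -/
private theorem convex_posSemidef_inter (L : AffineSubspace ℝ (Matrix (Fin k) (Fin k) ℝ)) :
    Convex ℝ {M : Matrix (Fin k) (Fin k) ℝ | M.PosSemidef ∧ M ∈ L} := by
  have h1 : Convex ℝ {M : Matrix (Fin k) (Fin k) ℝ | M.PosSemidef} := by
    intro M hM N hN s t hs ht _
    exact (hM.smul hs).add (hN.smul ht)
  have h2 : Convex ℝ (L : Set (Matrix (Fin k) (Fin k) ℝ)) := L.convex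
  simpa [Set.setOf_and] using h1.inter h2

/-! #### Theorem 3.3, direction "sandwiched psd lift ⇒ psd factorization" -/

/-- **FGPRT Theorem 3.3 / GRT Prop. 3.6, direction "lift ⇒ factorization"** (p09–p10): if points
`x_1,…,x_v` lie in a set `C = π(S^k_+ ∩ L)` (a psd lift of size `k ≥ 1`) contained in a BOUNDED
polyhedron `Q = {y : a_jᵀ y ≤ b_j}`, then the slack matrix `(b_j − a_jᵀ x_i)_{ij}` has a psd
factorization of size `k`. Printed proof: `A_i` = a preimage of `x_i` in `S^k_+ ∩ L`; `B_j ⪰ 0` with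
`b_j − a_jᵀ π(M) = ⟨M, B_j⟩` "by Farkas' lemma". Formalised with the two repairs the sketch leaves
implicit: (1) the duality step is the Slater-free certificate
`exists_posSemidef_certificate_of_le_on_psdLift` (facial reduction), which yields
`b_j − a_jᵀπ(M) = ⟨U_j, M⟩ + μ_j` on `S^k_+ ∩ L` with a constant `μ_j ≥ 0`; (2) the constants are
absorbed into the psd factors: writing `±(y₁ − y₂) = Σ_j λ^±_j a_j` with `λ^± ≥ 0` for two points
`y₁ ≠ y₂` of `C` (LP duality, `Q` bounded), the combination `Σ_j (λ⁺+λ⁻)_j (b_j − a_jᵀy)` is a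
constant `w`, so `E = (Σ_j (λ⁺+λ⁻)_j U_j)/(w − Σ_j (λ⁺+λ⁻)_j μ_j) ⪰ 0` satisfies `⟨E, M⟩ = 1` on
`S^k_+ ∩ L` (the denominator is positive, otherwise `(y₁−y₂)ᵀy` would be constant on `C`), and
`B_j = U_j + μ_j E`. When `C` is a single point the factorization is `A_i = I_k`, `B_j = (s_j/k) I_k`.
Boundedness of `Q` cannot be dropped (module docstring: `P = [1,2] ⊂ Q = {x ≥ 0, x ≥ −1}`).
[cite: FawziEtAl2015, Thm. 3.3 (p09–p10)] -/
theorem HasPsdLift.hasPsdFactorization_pairSlackMatrix {n v f k : ℕ} {x : Fin v → (Fin n → ℝ)}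
    {a : Fin f → (Fin n → ℝ)} {b : Fin f → ℝ} (hk : 1 ≤ k) {C : Set (Fin n → ℝ)}
    (hC : HasPsdLift C k) (hxC : ∀ i, x i ∈ C) (hCQ : C ⊆ {y | ∀ j, a j ⬝ᵥ y ≤ b j})
    (hQ : Bornology.IsBounded {y : Fin n → ℝ | ∀ j, a j ⬝ᵥ y ≤ b j}) :
    HasPsdFactorization (pairSlackMatrix x a b) k := by
  classical
  obtain ⟨L, π, rfl⟩ := hC
  have hk0 : (k : ℝ) ≠ 0 := by exact_mod_cast Nat.one_le_iff_ne_zero.mp hk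
  by_cases hsub : (π '' {M : Matrix (Fin k) (Fin k) ℝ | M.PosSemidef ∧ M ∈ L}).Subsingleton
  · -- `C` is a point (or empty): `S_{ij} = s_j ≥ 0`, factor through the identity
    rcases isEmpty_or_nonempty (Fin v) with hv | ⟨⟨i₀⟩⟩
    · exact ⟨fun i => isEmptyElim i, fun _ => 0, fun i => isEmptyElim i, fun _ => PosSemidef.zero,
        fun i => isEmptyElim i⟩
    · have hxi : ∀ i, x i = x i₀ := fun i => hsub (hxC i) (hxC i₀)
      have hs : ∀ j, 0 ≤ b j - a j ⬝ᵥ x i₀ := fun j => sub_nonneg.mpr (hCQ (hxC i₀) j)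
      refine ⟨fun _ => 1, fun j => ((b j - a j ⬝ᵥ x i₀) / k) • (1 : Matrix (Fin k) (Fin k) ℝ),
        fun _ => PosSemidef.one, fun j => PosSemidef.one.smul (div_nonneg (hs j) (Nat.cast_nonneg k)),
        fun i j => ?_⟩
      rw [pairSlackMatrix_apply, hxi i, Matrix.one_mul, trace_smul, trace_one, smul_eq_mul,
        Fintype.card_fin]
      field_simp
  · -- two distinct points `π M₁ ≠ π M₂` of `C`
    obtain ⟨_, ⟨M₁, hM₁, rfl⟩, _, ⟨M₂, hM₂, rfl⟩, hne⟩ := Set.not_subsingleton_iff.mp hsub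
    -- conic-duality certificates for every inequality of `Q`
    have hcert : ∀ j, ∃ U : Matrix (Fin k) (Fin k) ℝ, U.PosSemidef ∧ ∃ μ : ℝ, 0 ≤ μ ∧
        ∀ M : Matrix (Fin k) (Fin k) ℝ, M.PosSemidef → M ∈ L →
          b j - a j ⬝ᵥ π M = (U * M).trace + μ := by
      intro j
      let g : Matrix (Fin k) (Fin k) ℝ →ₗ[ℝ] ℝ :=
        { toFun := fun M => a j ⬝ᵥ π M
          map_add' := fun M N => by simp only [map_add, dotProduct_add]
          map_smul' := fun c M => by simp only [map_smul, dotProduct_smul, RingHom.id_apply] }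
      exact exists_posSemidef_certificate_of_le_on_psdLift L g (b j) ⟨M₁, hM₁⟩
        fun M hM hML => hCQ ⟨M, ⟨hM, hML⟩, rfl⟩ j
    choose U hU μ hμ hUμ using hcert
    -- preimages `A_i ∈ S^k_+ ∩ L` of the points `x_i`
    have hpre : ∀ i, ∃ M : Matrix (Fin k) (Fin k) ℝ, (M.PosSemidef ∧ M ∈ L) ∧ π M = x i :=
      fun i => hxC i
    choose A hA hAx using hpre
    -- dual multipliers for `±c`, `c = π M₁ − π M₂ ≠ 0`
    set c : Fin n → ℝ := π M₁ - π M₂ with hc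
    have hc0 : c ≠ 0 := sub_ne_zero.mpr hne
    have hQne : ∃ y : Fin n → ℝ, ∀ j, a j ⬝ᵥ y ≤ b j := ⟨π M₁, hCQ ⟨M₁, hM₁, rfl⟩⟩
    obtain ⟨lam, hlam, hlamA⟩ := exists_nonneg_vecMul_eq_of_isBounded a b hQne hQ c
    obtain ⟨lam', hlam', hlam'A⟩ := exists_nonneg_vecMul_eq_of_isBounded a b hQne hQ (-c)
    have hνA : (lam + lam') ᵥ* Matrix.of a = 0 := by
      rw [add_vecMul, hlamA, hlam'A, add_neg_cancel]
    -- `Σ_j lam_j (a_jᵀ y) = cᵀ y` and `Σ_j (lam+lam')_j (a_jᵀ y) = 0`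
    have hcomb : ∀ (w : Fin f → ℝ) (y : Fin n → ℝ),
        ∑ j, w j * (a j ⬝ᵥ y) = (w ᵥ* Matrix.of a) ⬝ᵥ y := by
      intro w y
      rw [← dotProduct_mulVec]
      rfl
    -- the psd factors pair to constants: `tr(Ū M) = w'` on `S^k_+ ∩ L`
    have htrsum : ∀ (w : Fin f → ℝ) (M : Matrix (Fin k) (Fin k) ℝ),
        ((∑ j, w j • U j) * M).trace = ∑ j, w j * (U j * M).trace := by
      intro w M
      simp only [Finset.sum_mul, Matrix.smul_mul, trace_sum, trace_smul, smul_eq_mul]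
    set w' : ℝ := (lam + lam') ⬝ᵥ b - ∑ j, (lam + lam') j * μ j with hw'
    have hUbar : ∀ M : Matrix (Fin k) (Fin k) ℝ, M.PosSemidef → M ∈ L →
        ∑ j, (lam + lam') j * (U j * M).trace = w' := by
      intro M hM hML
      have h1 : ∑ j, (lam + lam') j * (b j - a j ⬝ᵥ π M) = (lam + lam') ⬝ᵥ b := by
        simp only [mul_sub, Finset.sum_sub_distrib, hcomb, hνA, zero_dotProduct, sub_zero]
        rfl
      have h2 : ∑ j, (lam + lam') j * (b j - a j ⬝ᵥ π M) =
          ∑ j, (lam + lam') j * (U j * M).trace + ∑ j, (lam + lam') j * μ j := by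
        rw [← Finset.sum_add_distrib]
        exact sum_congr rfl fun j _ => by rw [hUμ j M hM hML, mul_add]
      rw [hw', ← h1, h2]
      ring
    have hν0 : ∀ j, 0 ≤ (lam + lam') j := fun j => add_nonneg (hlam j) (hlam' j)
    -- `w' > 0`: otherwise `cᵀ y` would be constant on `C`
    have hw'pos : 0 < w' := by
      by_contra hle
      push Not at hle
      have hterm : ∀ M : Matrix (Fin k) (Fin k) ℝ, M.PosSemidef → M ∈ L →
          ∀ j, lam j * (U j * M).trace = 0 := by
        intro M hM hML j
        have hnn : ∀ j ∈ (univ : Finset (Fin f)), 0 ≤ (lam + lam') j * (U j * M).trace :=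
          fun j _ => mul_nonneg (hν0 j) (trace_mul_nonneg (hU j) hM)
        have hsum0 : ∑ j, (lam + lam') j * (U j * M).trace = 0 :=
          le_antisymm (by rw [hUbar M hM hML]; exact hle) (sum_nonneg hnn)
        have hj := (sum_eq_zero_iff_of_nonneg hnn).mp hsum0 j (mem_univ j)
        have ht : 0 ≤ (U j * M).trace := trace_mul_nonneg (hU j) hM
        have h1 : lam j * (U j * M).trace ≤ (lam + lam') j * (U j * M).trace :=
          mul_le_mul_of_nonneg_right (by simpa using hlam' j) ht
        rw [hj] at h1
        exact le_antisymm h1 (mul_nonneg (hlam j) ht)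
      have hcπ : ∀ M : Matrix (Fin k) (Fin k) ℝ, M.PosSemidef → M ∈ L →
          c ⬝ᵥ π M = lam ⬝ᵥ b - ∑ j, lam j * μ j := by
        intro M hM hML
        have h1 : ∑ j, lam j * (b j - a j ⬝ᵥ π M) = lam ⬝ᵥ b - c ⬝ᵥ π M := by
          simp only [mul_sub, Finset.sum_sub_distrib, hcomb, hlamA]
          rfl
        have h2 : ∑ j, lam j * (b j - a j ⬝ᵥ π M) = ∑ j, lam j * μ j :=
          sum_congr rfl fun j _ => by rw [hUμ j M hM hML, mul_add, hterm M hM hML j, zero_add]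
        linarith
      have h12 : c ⬝ᵥ (π M₁ - π M₂) = 0 := by
        rw [dotProduct_sub, hcπ M₁ hM₁.1 hM₁.2, hcπ M₂ hM₂.1 hM₂.2, sub_self]
      exact hc0 (dotProduct_self_eq_zero.mp h12)
    -- `E ⪰ 0` with `tr(E M) = 1` on `S^k_+ ∩ L`
    set E : Matrix (Fin k) (Fin k) ℝ := w'⁻¹ • ∑ j, (lam + lam') j • U j with hE
    have hEpsd : E.PosSemidef :=
      (posSemidef_sum univ fun j _ => (hU j).smul (hν0 j)).smul (inv_nonneg.mpr hw'pos.le)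
    have hE1 : ∀ M : Matrix (Fin k) (Fin k) ℝ, M.PosSemidef → M ∈ L → (E * M).trace = 1 := by
      intro M hM hML
      rw [hE, Matrix.smul_mul, trace_smul, smul_eq_mul, htrsum, hUbar M hM hML]
      exact inv_mul_cancel₀ hw'pos.ne'
    refine ⟨A, fun j => U j + μ j • E, fun i => (hA i).1, fun j => (hU j).add (hEpsd.smul (hμ j)),
      fun i j => ?_⟩
    show b j - a j ⬝ᵥ x i = (A i * (U j + μ j • E)).trace
    rw [← hAx i, hUμ j (A i) (hA i).1 (hA i).2, Matrix.mul_add, trace_add, Matrix.mul_smul,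
      trace_smul, smul_eq_mul, trace_mul_comm (A i) (U j), trace_mul_comm (A i) E,
      hE1 (A i) (hA i).1 (hA i).2, mul_one]

/-! #### Theorem 3.3, direction "psd factorization ⇒ sandwiched psd lift" -/

/-- **FGPRT Theorem 3.3 / GRT Prop. 3.6, direction "factorization ⇒ lift"** (p09–p10): from a psd
factorization `b_j − a_jᵀx_i = ⟨A_i, B_j⟩` of size `k ≥ 1`, with `Q = {y : a_jᵀy ≤ b_j}` BOUNDED, the
printed set `C = {y : ∃ M ⪰ 0, b_j − a_jᵀ y = ⟨M, B_j⟩ ∀ j}` satisfies `conv(x_i) ⊆ C ⊆ Q` and is a psd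
lift of size `k`: `C = π(S^k_+ ∩ L)` with `L = {M : (⟨M,B_j⟩)_j ∈ b − A(ℝⁿ)}` and `π = −G ∘ (M ↦
(⟨M,B_j⟩)_j)`, where `G` is a linear left inverse of `y ↦ (a_jᵀy)_j` with `G b = 0` (it exists
because `Q` is bounded and nonempty, so `y ↦ (a_jᵀy)_j` is injective, and `b` is not of the form
`(a_jᵀy₀)_j` unless `Q = {y₀}`, in which case `C = {y₀}` is taken instead; `C = ∅` when there are
no points). This is the "it is not too difficult to show that `C` can be expressed in the desired
form" step, with `π` LINEAR as eq. (3) demands. [cite: FawziEtAl2015, Thm. 3.3 (p09–p10)] -/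
theorem HasPsdFactorization.exists_hasPsdLift_between {n v f k : ℕ} {x : Fin v → (Fin n → ℝ)}
    {a : Fin f → (Fin n → ℝ)} {b : Fin f → ℝ} (hk : 1 ≤ k)
    (h : HasPsdFactorization (pairSlackMatrix x a b) k)
    (hQ : Bornology.IsBounded {y : Fin n → ℝ | ∀ j, a j ⬝ᵥ y ≤ b j}) :
    ∃ C : Set (Fin n → ℝ), convexHull ℝ (Set.range x) ⊆ C ∧ C ⊆ {y | ∀ j, a j ⬝ᵥ y ≤ b j} ∧
      HasPsdLift C k := by
  classical
  obtain ⟨A, B, hA, hB, hS⟩ := h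
  have hxQ : ∀ i j, a j ⬝ᵥ x i ≤ b j := fun i j => by
    have h1 := hS i j
    rw [pairSlackMatrix_apply] at h1
    linarith [trace_mul_nonneg (hA i) (hB j)]
  rcases isEmpty_or_nonempty (Fin v) with hv | ⟨⟨i₀⟩⟩
  · refine ⟨∅, ?_, Set.empty_subset _, hasPsdLift_empty k⟩
    rw [Set.range_eq_empty, convexHull_empty]
  by_cases htight : ∃ y₀ : Fin n → ℝ, ∀ j, a j ⬝ᵥ y₀ = b j
  · -- all inequalities tight at `y₀`: `Q = {y₀}` by boundedness
    obtain ⟨y₀, hy₀⟩ := htight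
    have hQpt : ∀ y : Fin n → ℝ, (∀ j, a j ⬝ᵥ y ≤ b j) → y = y₀ := by
      intro y hy
      have hz := eq_zero_of_ray_subset hQ (y := y₀) (z := y - y₀) fun t ht j => by
        show a j ⬝ᵥ (y₀ + t • (y - y₀)) ≤ b j
        rw [dotProduct_add, dotProduct_smul, smul_eq_mul, dotProduct_sub, hy₀ j]
        nlinarith [hy j]
      exact sub_eq_zero.mp hz
    refine ⟨{y₀}, ?_, ?_, hasPsdLift_singleton y₀ hk⟩
    · refine convexHull_min ?_ (convex_singleton y₀)
      rintro _ ⟨i, rfl⟩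
      exact hQpt _ (hxQ i)
    · intro y hy j
      rw [Set.mem_singleton_iff] at hy
      rw [hy, hy₀ j]
  · -- generic case: `y ↦ (a_jᵀ y)_j` is injective and `b` is not in its range
    let T : (Fin n → ℝ) →ₗ[ℝ] (Fin f → ℝ) := Matrix.mulVecLin (Matrix.of a)
    have hT : ∀ y j, T y j = a j ⬝ᵥ y := fun y j => rfl
    let T' : ((Fin n → ℝ) × ℝ) →ₗ[ℝ] (Fin f → ℝ) :=
      T.coprod (LinearMap.toSpanSingleton ℝ (Fin f → ℝ) b)
    have hT' : ∀ (y : Fin n → ℝ) (s : ℝ) j, T' (y, s) j = a j ⬝ᵥ y + s * b j := by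
      intro y s j
      simp [T', hT]
    have hT'inj : LinearMap.ker T' = ⊥ := by
      rw [LinearMap.ker_eq_bot']
      rintro ⟨y, s⟩ hys
      have hys' : ∀ j, a j ⬝ᵥ y + s * b j = 0 := fun j => by rw [← hT']; exact congrFun hys j
      by_cases hs : s = 0
      · subst hs
        have hy0 : y = 0 := eq_zero_of_ray_subset hQ (y := x i₀) (z := y) fun t ht j => by
          show a j ⬝ᵥ (x i₀ + t • y) ≤ b j
          have h0 : a j ⬝ᵥ y = 0 := by simpa using hys' j
          rw [dotProduct_add, dotProduct_smul, smul_eq_mul, h0, mul_zero, add_zero]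
          exact hxQ i₀ j
        rw [hy0]
        rfl
      · exfalso
        refine htight ⟨-(s⁻¹ • y), fun j => ?_⟩
        rw [dotProduct_neg, dotProduct_smul, smul_eq_mul]
        have := hys' j
        field_simp
        linarith
    obtain ⟨G', hG'⟩ := T'.exists_leftInverse_of_injective hT'inj
    let G : (Fin f → ℝ) →ₗ[ℝ] (Fin n → ℝ) := (LinearMap.fst ℝ (Fin n → ℝ) ℝ).comp G'
    have hG'T' : ∀ p : (Fin n → ℝ) × ℝ, G' (T' p) = p := fun p => LinearMap.congr_fun hG' p
    have hGT : ∀ y, G (T y) = y := fun y => by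
      have h1 := hG'T' (y, 0)
      have h2 : T' (y, 0) = T y := by
        ext j
        rw [hT', hT, zero_mul, add_zero]
      show (G' (T y)).1 = y
      rw [← h2, h1]
    have hGb : G b = 0 := by
      have h1 := hG'T' (0, 1)
      have h2 : T' ((0 : Fin n → ℝ), (1 : ℝ)) = b := by
        ext j
        rw [hT', dotProduct_zero, one_mul, zero_add]
      show (G' b).1 = 0
      rw [← h2, h1]
    -- `Φ M = (tr(M B_j))_j`, `L = Φ⁻¹(b + range T)`, `π = −G ∘ Φ`
    let Φ : Matrix (Fin k) (Fin k) ℝ →ₗ[ℝ] (Fin f → ℝ) :=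
      { toFun := fun M j => (M * B j).trace
        map_add' := fun M N => funext fun j => by
          simp only [Matrix.add_mul, trace_add, Pi.add_apply]
        map_smul' := fun c M => funext fun j => by
          simp only [Matrix.smul_mul, trace_smul, Pi.smul_apply, RingHom.id_apply] }
    have hΦ : ∀ M j, Φ M j = (M * B j).trace := fun M j => rfl
    let Laff : AffineSubspace ℝ (Matrix (Fin k) (Fin k) ℝ) :=
      (AffineSubspace.mk' b (LinearMap.range T)).comap Φ.toAffineMap
    have hLaff : ∀ M : Matrix (Fin k) (Fin k) ℝ,
        M ∈ Laff ↔ ∃ y : Fin n → ℝ, ∀ j, a j ⬝ᵥ y = (M * B j).trace - b j := by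
      intro M
      simp only [Laff, AffineSubspace.mem_comap, LinearMap.coe_toAffineMap, AffineSubspace.mem_mk',
        vsub_eq_sub, LinearMap.mem_range]
      constructor
      · rintro ⟨y, hy⟩
        exact ⟨y, fun j => by rw [← hT, hy, Pi.sub_apply, hΦ]⟩
      · rintro ⟨y, hy⟩
        exact ⟨y, funext fun j => by rw [hT, hy, Pi.sub_apply, hΦ]⟩
    let π : Matrix (Fin k) (Fin k) ℝ →ₗ[ℝ] (Fin n → ℝ) := -(G.comp Φ)
    have hπ : ∀ M, π M = -G (Φ M) := fun M => rfl
    refine ⟨π '' {M | M.PosSemidef ∧ M ∈ Laff}, ?_, ?_, ⟨Laff, π, rfl⟩⟩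
    · -- `P ⊆ C`: the vertices lift to the `A_i`, and `C` is convex
      refine convexHull_min ?_ ((convex_posSemidef_inter Laff).linear_image π)
      rintro _ ⟨i, rfl⟩
      have hΦA : Φ (A i) = b - T (x i) := funext fun j => by
        rw [hΦ, ← hS i j, pairSlackMatrix_apply, Pi.sub_apply, hT]
      refine ⟨A i, ⟨hA i, (hLaff _).mpr ⟨-x i, fun j => ?_⟩⟩, ?_⟩
      · rw [dotProduct_neg, ← hS i j, pairSlackMatrix_apply]
        ring
      · rw [hπ, hΦA, map_sub, hGb, hGT, zero_sub, neg_neg]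
    · -- `C ⊆ Q`: `a_jᵀ π(M) = b_j − tr(M B_j) ≤ b_j`
      rintro _ ⟨M, ⟨hM, hML⟩, rfl⟩ j
      obtain ⟨y, hy⟩ := (hLaff M).mp hML
      have hΦM : Φ M = T y + b := funext fun j' => by
        rw [Pi.add_apply, hΦ, hT, hy j']
        ring
      have hπM : π M = -y := by
        rw [hπ, hΦM, map_add, hGT, hGb, add_zero]
      show a j ⬝ᵥ π M ≤ b j
      rw [hπM, dotProduct_neg, hy j]
      linarith [trace_mul_nonneg hM (hB j)]

/-! #### The two named facts -/

/-- **Discharge of `FawziEtAl2015_thm33`** (Theorem 3.3, case `P = Q`: a polytope has a psd lift of size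
`k` iff its slack matrix has a psd factorization of size `k`). "⇒" of the iff
(`HasPsdFactorization → HasPsdLift`): the sandwiched lift of
`HasPsdFactorization.exists_hasPsdLift_between` is squeezed, `P ⊆ C ⊆ Q = P`; "⇐":
`HasPsdLift.hasPsdFactorization_pairSlackMatrix` with `C = P` (a polytope is bounded).
[cite: FawziEtAl2015, Thm. 3.3 (p09–p10)] -/
theorem FawziEtAl2015_thm33_holds : FawziEtAl2015_thm33 := by
  intro n v f k x a b hk hPQ
  have hQ : Bornology.IsBounded {y : Fin n → ℝ | ∀ j, a j ⬝ᵥ y ≤ b j} := by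
    rw [← hPQ]
    exact isBounded_convexHull.mpr (Set.finite_range x).isBounded
  constructor
  · intro h
    obtain ⟨C, hPC, hCQ, hC⟩ := h.exists_hasPsdLift_between hk hQ
    have hCP : C = convexHull ℝ (Set.range x) :=
      Set.Subset.antisymm (by rw [hPQ]; exact hCQ) hPC
    rwa [hCP] at hC
  · intro h
    exact h.hasPsdFactorization_pairSlackMatrix hk (fun i => subset_convexHull ℝ _ ⟨i, rfl⟩)
      (by rw [hPQ]) hQ

/-- **Discharge of `FawziEtAl2015_thm33_pair`** (Theorem 3.3 for a pair `P ⊆ Q`, `Q` a bounded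
polytope: `S_{P,Q}` has a psd factorization of size `k` iff some psd lift of size `k` is sandwiched
between `P` and `Q`), by the two directions above; the full-dimensionality hypothesis of the typed
statement is not used. [cite: FawziEtAl2015, Thm. 3.3 (p09–p10)] -/
theorem FawziEtAl2015_thm33_pair_holds : FawziEtAl2015_thm33_pair := by
  intro n v f k x a b hk _hxQ hQ _hint
  constructor
  · intro h
    exact h.exists_hasPsdLift_between hk hQ
  · rintro ⟨C, hPC, hCQ, hC⟩
    exact hC.hasPsdFactorization_pairSlackMatrix hk
      (fun i => hPC (subset_convexHull ℝ _ ⟨i, rfl⟩)) hCQ hQ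

end Thm33

/-! ### Discharge of `FawziEtAl2015_sec4_ellipse`: psd rank two of planar slack matrices = sandwiched ellipses -/

section Sec4Ellipse

/-! #### `2 × 2` real symmetric matrices -/

/-- The quadratic form of a symmetric `2 × 2` matrix. [folklore] -/
private theorem dotProduct_mulVec_fin_two (M : Matrix (Fin 2) (Fin 2) ℝ) (y : Fin 2 → ℝ) :
    y ⬝ᵥ (M *ᵥ y) = M 0 0 * y 0 * y 0 + (M 0 1 + M 1 0) * y 0 * y 1 + M 1 1 * y 1 * y 1 := by
  simp [dotProduct, mulVec, Fin.sum_univ_two]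
  ring

/-- A real `2 × 2` matrix is positive semidefinite iff it is symmetric with nonnegative diagonal and
nonnegative determinant. [folklore] -/
private theorem posSemidef_fin_two_iff (M : Matrix (Fin 2) (Fin 2) ℝ) :
    M.PosSemidef ↔ M 1 0 = M 0 1 ∧ 0 ≤ M 0 0 ∧ 0 ≤ M 1 1 ∧ M 0 1 ^ 2 ≤ M 0 0 * M 1 1 := by
  rw [posSemidef_iff_dotProduct_mulVec]
  constructor
  · rintro ⟨hH, hq⟩
    have hsym : M 1 0 = M 0 1 := by
      have := congrFun (congrFun hH 0) 1
      simpa [conjTranspose_apply] using this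
    have hq' : ∀ y : Fin 2 → ℝ, 0 ≤ M 0 0 * y 0 * y 0 + 2 * M 0 1 * y 0 * y 1 + M 1 1 * y 1 * y 1 := by
      intro y
      have h := hq y
      rw [star_trivial, dotProduct_mulVec_fin_two, hsym] at h
      linarith
    have h00 : 0 ≤ M 0 0 := by simpa using hq' ![1, 0]
    have h11 : 0 ≤ M 1 1 := by simpa using hq' ![0, 1]
    refine ⟨hsym, h00, h11, ?_⟩
    rcases h00.lt_or_eq with hpos | hzero
    · -- `y = (M 0 1, −M 0 0)`
      have h := hq' ![M 0 1, -M 0 0]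
      simp only [Matrix.cons_val_zero, Matrix.cons_val_one] at h
      nlinarith
    · -- `M 0 0 = 0` forces `M 0 1 = 0`: test `y = (1, −c·M 0 1)` with small `c > 0`
      rw [← hzero, zero_mul]
      suffices h : M 0 1 = 0 by rw [h]; norm_num
      by_contra hne
      set c : ℝ := 1 / (|M 1 1| + 1) with hc
      have hcpos : 0 < c := by rw [hc]; positivity
      have h := hq' ![1, -(c * M 0 1)]
      simp only [Matrix.cons_val_zero, Matrix.cons_val_one, ← hzero] at h
      -- `h : 0 ≤ 0 − 2c (M01)² + M11 c² (M01)² = c (M01)² (M11 c − 2)`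
      have hsq : 0 < M 0 1 ^ 2 := by positivity
      have hM11 : M 1 1 * c ≤ 1 := by
        rw [hc]
        rw [mul_one_div, div_le_one (by positivity)]
        linarith [le_abs_self (M 1 1)]
      have hfac : (0 : ℝ) * 1 * 1 + 2 * M 0 1 * 1 * -(c * M 0 1) + M 1 1 * -(c * M 0 1) * -(c * M 0 1) =
          c * M 0 1 ^ 2 * (M 1 1 * c - 2) := by ring
      rw [hfac] at h
      have hneg : c * M 0 1 ^ 2 * (M 1 1 * c - 2) < 0 :=
        mul_neg_of_pos_of_neg (mul_pos hcpos hsq) (by linarith)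
      linarith
  · rintro ⟨hsym, h00, h11, hdet⟩
    refine ⟨?_, fun y => ?_⟩
    · ext i j
      fin_cases i <;> fin_cases j <;> simp [conjTranspose_apply, hsym]
    · rw [star_trivial, dotProduct_mulVec_fin_two, hsym]
      rcases h00.lt_or_eq with hpos | hzero
      · -- complete the square: `p·form = (p y0 + s y1)² + (pr − s²) y1²`
        have h1 : M 0 0 * (M 0 0 * y 0 * y 0 + (M 0 1 + M 0 1) * y 0 * y 1 + M 1 1 * y 1 * y 1) =
            (M 0 0 * y 0 + M 0 1 * y 1) ^ 2 + (M 0 0 * M 1 1 - M 0 1 ^ 2) * y 1 ^ 2 := by ring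
        have h2 : 0 ≤ (M 0 0 * y 0 + M 0 1 * y 1) ^ 2 + (M 0 0 * M 1 1 - M 0 1 ^ 2) * y 1 ^ 2 := by
          have : 0 ≤ (M 0 0 * M 1 1 - M 0 1 ^ 2) * y 1 ^ 2 := mul_nonneg (by linarith) (sq_nonneg _)
          positivity
        rw [← h1] at h2
        exact nonneg_of_mul_nonneg_right h2 hpos
      · have hs : M 0 1 = 0 := by
          rw [← hzero, zero_mul] at hdet
          exact pow_eq_zero_iff (n := 2) (by norm_num) |>.mp (le_antisymm hdet (sq_nonneg _))
        rw [← hzero, hs]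
        nlinarith [sq_nonneg (y 1)]

/-- A symmetric `2 × 2` matrix with nonnegative determinant is semidefinite: psd if its trace is
nonnegative. [folklore] -/
private theorem posSemidef_fin_two_of_det_of_trace (M : Matrix (Fin 2) (Fin 2) ℝ) (hsym : M 1 0 = M 0 1)
    (hdet : M 0 1 ^ 2 ≤ M 0 0 * M 1 1) (htr : 0 ≤ M 0 0 + M 1 1) : M.PosSemidef := by
  rw [posSemidef_fin_two_iff]
  have hsq : 0 ≤ M 0 0 * M 1 1 := le_trans (sq_nonneg _) hdet
  refine ⟨hsym, ?_, ?_, hdet⟩ <;> nlinarith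

/-- A symmetric `2 × 2` matrix with nonnegative determinant and zero trace vanishes. [folklore] -/
private theorem eq_zero_fin_two_of_det_of_trace (M : Matrix (Fin 2) (Fin 2) ℝ) (hsym : M 1 0 = M 0 1)
    (hdet : M 0 1 ^ 2 ≤ M 0 0 * M 1 1) (htr : M 0 0 + M 1 1 = 0) : M = 0 := by
  have h11 : M 1 1 = -M 0 0 := by linarith
  have h00 : M 0 0 = 0 := by nlinarith [sq_nonneg (M 0 0), sq_nonneg (M 0 1)]
  have h01 : M 0 1 = 0 := by
    rw [h00, zero_mul] at hdet
    exact pow_eq_zero_iff (n := 2) (by norm_num) |>.mp (le_antisymm hdet (sq_nonneg _))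
  ext i j
  fin_cases i <;> fin_cases j <;> simp [h00, h01, hsym, h11]

/-! #### Ellipses have psd lifts of size two -/

/-- **Every planar ellipse region `{y : yᵀAy + 2cᵀy + γ ≤ 0}`, `A ≻ 0`, has a psd lift of size `2`**
(the geometric fact behind "an ellipse sandwiched between `P` and `Q` gives `rank_psd S_{P,Q} = 2`",
§4 p13): after completing the square the region is empty, a point, or `y₀ + φ⁻¹(√ρ·𝔻)`, and the disk
of radius `√ρ` is `{((M₁₁ − M₂₂)/2, M₁₂) : M ⪰ 0, tr M = 2√ρ}` (`S^2_+` is the Lorentz cone).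
[cite: FawziEtAl2015, §4 (p13)] -/
theorem hasPsdLift_ellipse (A : Matrix (Fin 2) (Fin 2) ℝ) (c : Fin 2 → ℝ) (γ : ℝ) (hA : A.PosDef) :
    HasPsdLift {y : Fin 2 → ℝ | y ⬝ᵥ (A *ᵥ y) + 2 * (c ⬝ᵥ y) + γ ≤ 0} 2 := by
  classical
  -- entries `A = [[p, q], [q, r]]`, `p > 0`, `δ = pr − q² > 0`
  set p : ℝ := A 0 0 with hp
  set q : ℝ := A 0 1 with hq
  set r : ℝ := A 1 1 with hr
  have hsym : A 1 0 = q := by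
    have := congrFun (congrFun hA.isHermitian 0) 1
    rw [hq]
    simpa [conjTranspose_apply] using this
  have hppos : 0 < p := by
    have := hA.diag_pos (i := 0)
    simpa [hp] using this
  have hδ : 0 < p * r - q ^ 2 := by
    have := hA.det_pos
    rw [Matrix.det_fin_two, hsym] at this
    nlinarith
  set δ : ℝ := p * r - q ^ 2 with hδdef
  -- the quadratic form and the centre `y₀ = −A⁻¹c`
  have hform : ∀ y : Fin 2 → ℝ, y ⬝ᵥ (A *ᵥ y) = p * y 0 * y 0 + 2 * q * y 0 * y 1 + r * y 1 * y 1 := by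
    intro y
    rw [dotProduct_mulVec_fin_two, hsym]
    simp only [hp, hq, hr]
    ring
  set y₀ : Fin 2 → ℝ := ![-(r * c 0 - q * c 1) / δ, -(-q * c 0 + p * c 1) / δ] with hy₀
  set ρ : ℝ := y₀ ⬝ᵥ (A *ᵥ y₀) - γ with hρ
  have hδ0 : δ ≠ 0 := hδ.ne'
  have hcomplete : ∀ y : Fin 2 → ℝ, y ⬝ᵥ (A *ᵥ y) + 2 * (c ⬝ᵥ y) + γ = (y - y₀) ⬝ᵥ (A *ᵥ (y - y₀)) - ρ := by
    intro y
    rw [hρ, hform, hform, hform]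
    simp only [hy₀, dotProduct, Fin.sum_univ_two, Pi.sub_apply, Matrix.cons_val_zero, Matrix.cons_val_one]
    field_simp
    ring
  -- the completed-square coordinates `φ` and their inverse `ψ`
  have hsp : 0 < Real.sqrt p := Real.sqrt_pos.mpr hppos
  have hsδ : 0 < Real.sqrt δ := Real.sqrt_pos.mpr hδ
  let φ : (Fin 2 → ℝ) → (Fin 2 → ℝ) := fun z =>
    ![Real.sqrt p * (z 0 + q / p * z 1), Real.sqrt δ / Real.sqrt p * z 1]
  let ψ : (Fin 2 → ℝ) → (Fin 2 → ℝ) := fun u =>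
    ![u 0 / Real.sqrt p - q / p * (Real.sqrt p / Real.sqrt δ * u 1), Real.sqrt p / Real.sqrt δ * u 1]
  have hpsq : Real.sqrt p * Real.sqrt p = p := Real.mul_self_sqrt hppos.le
  have hδsq : Real.sqrt δ * Real.sqrt δ = δ := Real.mul_self_sqrt hδ.le
  have hφnorm : ∀ z : Fin 2 → ℝ, φ z 0 ^ 2 + φ z 1 ^ 2 = z ⬝ᵥ (A *ᵥ z) := by
    intro z
    rw [hform]
    simp only [φ, Matrix.cons_val_zero, Matrix.cons_val_one]
    rw [mul_pow, mul_pow, div_pow, Real.sq_sqrt hppos.le, Real.sq_sqrt hδ.le, hδdef]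
    field_simp
    ring
  have hψφ : ∀ z : Fin 2 → ℝ, ψ (φ z) = z := by
    intro z
    have h0 : ψ (φ z) 0 = z 0 := by
      simp only [ψ, φ, Matrix.cons_val_zero, Matrix.cons_val_one]
      field_simp
      ring
    have h1 : ψ (φ z) 1 = z 1 := by
      simp only [ψ, φ, Matrix.cons_val_zero, Matrix.cons_val_one]
      field_simp
    ext i
    fin_cases i
    · exact h0
    · exact h1
  have hφψ : ∀ u : Fin 2 → ℝ, φ (ψ u) = u := by
    intro u
    have h0 : φ (ψ u) 0 = u 0 := by
      simp only [ψ, φ, Matrix.cons_val_zero, Matrix.cons_val_one]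
      field_simp
      ring
    have h1 : φ (ψ u) 1 = u 1 := by
      simp only [ψ, φ, Matrix.cons_val_zero, Matrix.cons_val_one]
      field_simp
    ext i
    fin_cases i
    · exact h0
    · exact h1
  have hψlin_add : ∀ u u' : Fin 2 → ℝ, ψ (u + u') = ψ u + ψ u' := by
    intro u u'
    ext i
    fin_cases i <;> simp [ψ] <;> ring
  have hψlin_smul : ∀ (s : ℝ) (u : Fin 2 → ℝ), ψ (s • u) = s • ψ u := by
    intro s u
    ext i
    fin_cases i <;> simp [ψ] <;> ring
  -- three cases for `ρ`
  rcases lt_trichotomy ρ 0 with hρneg | hρzero | hρpos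
  · -- empty ellipse
    have hE : {y : Fin 2 → ℝ | y ⬝ᵥ (A *ᵥ y) + 2 * (c ⬝ᵥ y) + γ ≤ 0} = ∅ := by
      refine Set.eq_empty_of_forall_notMem fun y hy => ?_
      rw [Set.mem_setOf_eq, hcomplete] at hy
      have : 0 ≤ (y - y₀) ⬝ᵥ (A *ᵥ (y - y₀)) := by simpa using hA.posSemidef.dotProduct_mulVec_nonneg (y - y₀)
      linarith
    rw [hE]
    exact hasPsdLift_empty 2
  · -- a single point `y₀`
    have hE : {y : Fin 2 → ℝ | y ⬝ᵥ (A *ᵥ y) + 2 * (c ⬝ᵥ y) + γ ≤ 0} = {y₀} := by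
      ext y
      rw [Set.mem_setOf_eq, hcomplete, hρzero, sub_zero, Set.mem_singleton_iff]
      constructor
      · intro h
        have h0 : (y - y₀) ⬝ᵥ (A *ᵥ (y - y₀)) = 0 :=
          le_antisymm h (by simpa using hA.posSemidef.dotProduct_mulVec_nonneg (y - y₀))
        by_contra hne
        have := hA.dotProduct_mulVec_pos (x := y - y₀) (sub_ne_zero.mpr hne)
        rw [star_trivial] at this
        linarith
      · intro h
        rw [h, sub_self, zero_dotProduct]
    rw [hE]
    exact hasPsdLift_singleton y₀ (by norm_num)
  · -- a genuine ellipse: the disk lift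
    have hsρ : 0 < Real.sqrt ρ := Real.sqrt_pos.mpr hρpos
    have hρsq : Real.sqrt ρ * Real.sqrt ρ = ρ := Real.mul_self_sqrt hρpos.le
    let T : Matrix (Fin 2) (Fin 2) ℝ →ₗ[ℝ] ℝ := Matrix.traceLinearMap (Fin 2) ℝ ℝ
    let L₀ : AffineSubspace ℝ (Matrix (Fin 2) (Fin 2) ℝ) :=
      (AffineSubspace.mk' (2 * Real.sqrt ρ) (⊥ : Submodule ℝ ℝ)).comap T.toAffineMap
    have hL₀ : ∀ M : Matrix (Fin 2) (Fin 2) ℝ, M ∈ L₀ ↔ M 0 0 + M 1 1 = 2 * Real.sqrt ρ := by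
      intro M
      simp only [L₀, AffineSubspace.mem_comap, LinearMap.coe_toAffineMap, AffineSubspace.mem_mk',
        vsub_eq_sub, Submodule.mem_bot, sub_eq_zero, T, Matrix.traceLinearMap_apply, Matrix.trace_fin_two]
    let π : Matrix (Fin 2) (Fin 2) ℝ →ₗ[ℝ] (Fin 2 → ℝ) :=
      { toFun := fun M => ((M 0 0 + M 1 1) / (2 * Real.sqrt ρ)) • y₀ + ψ ![(M 0 0 - M 1 1) / 2, M 0 1]
        map_add' := fun M M' => by
          have : (![((M + M') 0 0 - (M + M') 1 1) / 2, (M + M') 0 1] : Fin 2 → ℝ) =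
              ![(M 0 0 - M 1 1) / 2, M 0 1] + ![(M' 0 0 - M' 1 1) / 2, M' 0 1] := by
            ext i
            fin_cases i
            · simp only [Pi.add_apply, Matrix.add_apply, Matrix.cons_val_zero, Fin.zero_eta]
              ring
            · simp only [Pi.add_apply, Matrix.add_apply, Matrix.cons_val_one, Matrix.cons_val_zero, Fin.mk_one]
          rw [this, hψlin_add]
          simp only [Matrix.add_apply]
          rw [show ((M 0 0 + M' 0 0 + (M 1 1 + M' 1 1)) / (2 * Real.sqrt ρ)) =
            (M 0 0 + M 1 1) / (2 * Real.sqrt ρ) + (M' 0 0 + M' 1 1) / (2 * Real.sqrt ρ) by ring, add_smul]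
          abel
        map_smul' := fun s M => by
          have : (![((s • M) 0 0 - (s • M) 1 1) / 2, (s • M) 0 1] : Fin 2 → ℝ) =
              s • ![(M 0 0 - M 1 1) / 2, M 0 1] := by
            ext i
            fin_cases i
            · simp only [Pi.smul_apply, Matrix.smul_apply, smul_eq_mul, Matrix.cons_val_zero, Fin.zero_eta]
              ring
            · simp only [Pi.smul_apply, Matrix.smul_apply, smul_eq_mul, Matrix.cons_val_one, Matrix.cons_val_zero,
                Fin.mk_one]
          rw [this, hψlin_smul]
          simp only [Matrix.smul_apply, smul_eq_mul, RingHom.id_apply, smul_add, smul_smul]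
          congr 1
          rw [show (s * M 0 0 + s * M 1 1) / (2 * Real.sqrt ρ) = s * ((M 0 0 + M 1 1) / (2 * Real.sqrt ρ)) by ring] }
    have hπ : ∀ M : Matrix (Fin 2) (Fin 2) ℝ,
        π M = ((M 0 0 + M 1 1) / (2 * Real.sqrt ρ)) • y₀ + ψ ![(M 0 0 - M 1 1) / 2, M 0 1] := fun M => rfl
    refine ⟨L₀, π, Set.Subset.antisymm ?_ ?_⟩
    · -- `E ⊆ π(S^2_+ ∩ L₀)`
      intro y hy
      rw [Set.mem_setOf_eq, hcomplete] at hy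
      set u := φ (y - y₀) with hu
      have hu2 : u 0 ^ 2 + u 1 ^ 2 ≤ ρ := by rw [hu, hφnorm]; linarith
      have hu0 : |u 0| ≤ Real.sqrt ρ := by
        rw [← Real.sqrt_sq_eq_abs]
        exact Real.sqrt_le_sqrt (by nlinarith [sq_nonneg (u 1)])
      let M : Matrix (Fin 2) (Fin 2) ℝ := !![Real.sqrt ρ + u 0, u 1; u 1, Real.sqrt ρ - u 0]
      have hM00 : M 0 0 = Real.sqrt ρ + u 0 := by simp [M]
      have hM01 : M 0 1 = u 1 := by simp [M]
      have hM10 : M 1 0 = u 1 := by simp [M]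
      have hM11 : M 1 1 = Real.sqrt ρ - u 0 := by simp [M]
      refine ⟨M, ⟨?_, ?_⟩, ?_⟩
      · rw [posSemidef_fin_two_iff, hM00, hM01, hM10, hM11]
        refine ⟨rfl, by linarith [neg_abs_le (u 0)], by linarith [le_abs_self (u 0)], ?_⟩
        nlinarith
      · rw [hL₀, hM00, hM11]
        ring
      · rw [hπ, hM00, hM01, hM11]
        have h1 : (Real.sqrt ρ + u 0 + (Real.sqrt ρ - u 0)) / (2 * Real.sqrt ρ) = 1 := by
          field_simp; ring
        have h2 : (![(Real.sqrt ρ + u 0 - (Real.sqrt ρ - u 0)) / 2, u 1] : Fin 2 → ℝ) = u := by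
          have : (Real.sqrt ρ + u 0 - (Real.sqrt ρ - u 0)) / 2 = u 0 := by ring
          rw [this]
          ext i
          fin_cases i <;> rfl
        rw [h1, one_smul, h2, hu, hψφ, add_sub_cancel]
    · -- `π(S^2_+ ∩ L₀) ⊆ E`
      rintro _ ⟨M, ⟨hM, hML⟩, rfl⟩
      rw [posSemidef_fin_two_iff] at hM
      obtain ⟨hMs, hM00, hM11, hMdet⟩ := hM
      rw [hL₀] at hML
      rw [Set.mem_setOf_eq, hcomplete, hπ]
      have h1 : (M 0 0 + M 1 1) / (2 * Real.sqrt ρ) = 1 := by rw [hML]; field_simp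
      rw [h1, one_smul, add_sub_cancel_left, ← hφnorm, hφψ]
      simp only [Matrix.cons_val_zero, Matrix.cons_val_one]
      -- `((M00 − M11)/2)² + M01² ≤ ρ` from `M00 M11 ≥ M01²`, `M00 + M11 = 2√ρ`
      nlinarith [hρsq]


/-! #### From a sandwiched psd lift of size two to an ellipse -/

/-- If the points `x_i` lie on a line, the slack matrix has rank `≤ 2`. [folklore] -/
private theorem rank_pairSlackMatrix_le_two_of_collinear {v f : ℕ} (x : Fin v → (Fin 2 → ℝ))
    (a : Fin f → (Fin 2 → ℝ)) (b : Fin f → ℝ) (i₀ : Fin v) (d : Fin 2 → ℝ) (t : Fin v → ℝ)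
    (hx : ∀ i, x i = x i₀ + t i • d) : (Matrix.of (pairSlackMatrix x a b)).rank ≤ 2 := by
  rw [Matrix.rank_eq_finrank_span_row]
  set u : Fin f → ℝ := fun j => b j - a j ⬝ᵥ x i₀ with hu
  set w : Fin f → ℝ := fun j => a j ⬝ᵥ d with hw
  have hrow : ∀ i, (Matrix.of (pairSlackMatrix x a b)).row i = u - t i • w := by
    intro i
    ext j
    simp only [Matrix.row, Matrix.of_apply, pairSlackMatrix_apply, hx i, hu, hw, Pi.sub_apply,
      Pi.smul_apply, smul_eq_mul, dotProduct_add, dotProduct_smul]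
    ring
  have hle : Submodule.span ℝ (Set.range (Matrix.of (pairSlackMatrix x a b)).row) ≤
      Submodule.span ℝ (Set.range ![u, w]) := by
    rw [Submodule.span_le]
    rintro _ ⟨i, rfl⟩
    rw [hrow i]
    exact sub_mem (Submodule.subset_span ⟨0, rfl⟩)
      (Submodule.smul_mem _ _ (Submodule.subset_span ⟨1, rfl⟩))
  calc Module.finrank ℝ (Submodule.span ℝ (Set.range (Matrix.of (pairSlackMatrix x a b)).row))
      ≤ Module.finrank ℝ (Submodule.span ℝ (Set.range ![u, w])) := Submodule.finrank_mono hle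
    _ ≤ Fintype.card (Fin 2) := finrank_range_le_card _
    _ = 2 := Fintype.card_fin 2

/-- If `rank S_{P,Q} = 3` for points in the plane, three of the points are affinely independent.
[folklore] -/
private theorem exists_three_points_of_rank_eq_three {v f : ℕ} (x : Fin v → (Fin 2 → ℝ))
    (a : Fin f → (Fin 2 → ℝ)) (b : Fin f → ℝ) (hrank : (Matrix.of (pairSlackMatrix x a b)).rank = 3) :
    ∃ i₀ i₁ i₂ : Fin v,
      (x i₁ - x i₀) 0 * (x i₂ - x i₀) 1 - (x i₁ - x i₀) 1 * (x i₂ - x i₀) 0 ≠ 0 := by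
  classical
  rcases isEmpty_or_nonempty (Fin v) with hv | ⟨⟨i₀⟩⟩
  · have h := Matrix.rank_le_card_height (Matrix.of (pairSlackMatrix x a b))
    rw [hrank, Fintype.card_eq_zero] at h
    omega
  by_contra hcon
  push Not at hcon
  have hle : (Matrix.of (pairSlackMatrix x a b)).rank ≤ 2 := by
    by_cases hall : ∀ i, x i = x i₀
    · exact rank_pairSlackMatrix_le_two_of_collinear x a b i₀ 0 (fun _ => 0) fun i => by
        rw [hall i, zero_smul, add_zero]
    · push Not at hall
      obtain ⟨i₁, hi₁⟩ := hall
      set d : Fin 2 → ℝ := x i₁ - x i₀ with hd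
      have hd0 : d ≠ 0 := sub_ne_zero.mpr hi₁
      -- every `x i − x i₀` is parallel to `d`
      let t : Fin v → ℝ := fun i => if d 0 ≠ 0 then (x i - x i₀) 0 / d 0 else (x i - x i₀) 1 / d 1
      refine rank_pairSlackMatrix_le_two_of_collinear x a b i₀ d t fun i => ?_
      have hdet : d 0 * (x i - x i₀) 1 - d 1 * (x i - x i₀) 0 = 0 := hcon i₀ i₁ i
      rw [← sub_eq_iff_eq_add']
      ext k
      by_cases hd00 : d 0 ≠ 0
      · have ht : t i = (x i - x i₀) 0 / d 0 := if_pos hd00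
        fin_cases k
        · simp only [Pi.smul_apply, smul_eq_mul, ht, Fin.zero_eta]
          field_simp
        · simp only [Pi.smul_apply, smul_eq_mul, ht, Fin.mk_one]
          field_simp
          linarith
      · push Not at hd00
        have hd1 : d 1 ≠ 0 := by
          intro h1
          apply hd0
          ext k
          fin_cases k
          · exact hd00
          · exact h1
        have ht : t i = (x i - x i₀) 1 / d 1 := if_neg (not_not.mpr hd00)
        have he0 : (x i - x i₀) 0 = 0 := by
          rw [hd00, zero_mul, zero_sub, neg_eq_zero] at hdet
          exact (mul_eq_zero.mp hdet).resolve_left hd1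
        fin_cases k
        · simp only [Pi.smul_apply, smul_eq_mul, ht, Fin.zero_eta, hd00, mul_zero]
          exact he0
        · simp only [Pi.smul_apply, smul_eq_mul, ht, Fin.mk_one]
          field_simp
  omega

/-- Entries of an explicit `2 × 2` matrix. [folklore] -/
private theorem posSemidef_single_fin_two (i : Fin 2) : (Matrix.single i i (1 : ℝ)).PosSemidef := by
  rw [posSemidef_fin_two_iff]
  fin_cases i <;> simp

/-- The all-ones `2 × 2` matrix is psd. [folklore] -/
private theorem posSemidef_ones_fin_two : (Matrix.of fun (_ _ : Fin 2) => (1 : ℝ)).PosSemidef := by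
  rw [posSemidef_fin_two_iff]
  simp

/-- **FGPRT §4 / GRT Prop. 4.1, direction "⇒"**: if points `x_i` whose slack matrix against a bounded
`Q = {a_jᵀy ≤ b_j} ⊂ ℝ²` has rank `3` lie in a psd lift `C = π(S^2_+ ∩ L)` of size `2` contained in `Q`,
then a nondegenerate ellipse `E = {yᵀAy + 2cᵀy + γ ≤ 0}`, `A ≻ 0`, satisfies `x_i ∈ E ⊆ Q`. Printed
argument (GRT13 p08): "`L` cannot be all of `S²` … `L` must be a two-dimensional slice and `π|_L`
invertible … `S^2_+` is the second-order cone, so `L ∩ S^2_+` is [an affine image of] a half-conic",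
bounded hence an ellipse. Formalised: three affinely independent `x_{i₀}, x_{i₁}, x_{i₂}` (rank `3`) with
preimages `M₀, M₁, M₂` give an affine section `N(y) = M₀ + λ₁(y)(M₁ − M₀) + λ₂(y)(M₂ − M₀)` of `π`;
every `M ∈ S^2_+ ∩ L` equals `N(π M)` (otherwise all symmetric matrices are directions of `L` and
`π` would vanish on `S^2_+` by boundedness), so `C = {y : N(y) ⪰ 0} = {tr N(y) ≥ 0, det N(y) ≥ 0}`;
`E := {det N(y) ≥ 0}` has `A = −`(quadratic part of `det N`) `≻ 0` because a semidefinite direction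
`y₁N₁ + y₂N₂` would give a ray in `C`, and `E ⊆ C` because a point of `E` with `N(y) ⪯ 0` would, by
convexity of `E` and an intermediate zero of the trace, force `N(z) = 0`, `z = π(0) = 0`, making `C` a
cone. [cite: FawziEtAl2015, §4 (p13)] -/
theorem exists_ellipse_of_hasPsdLift_two {v f : ℕ} {x : Fin v → (Fin 2 → ℝ)} {a : Fin f → (Fin 2 → ℝ)}
    {b : Fin f → ℝ} (hQ : Bornology.IsBounded {y : Fin 2 → ℝ | ∀ j, a j ⬝ᵥ y ≤ b j})
    (hrank : (Matrix.of (pairSlackMatrix x a b)).rank = 3) {C : Set (Fin 2 → ℝ)} (hC : HasPsdLift C 2)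
    (hxC : ∀ i, x i ∈ C) (hCQ : C ⊆ {y | ∀ j, a j ⬝ᵥ y ≤ b j}) :
    ∃ (A : Matrix (Fin 2) (Fin 2) ℝ) (c : Fin 2 → ℝ) (γ : ℝ), A.PosDef ∧
      (∀ i, x i ⬝ᵥ (A *ᵥ x i) + 2 * (c ⬝ᵥ x i) + γ ≤ 0) ∧
      ∀ y : Fin 2 → ℝ, y ⬝ᵥ (A *ᵥ y) + 2 * (c ⬝ᵥ y) + γ ≤ 0 → ∀ j, a j ⬝ᵥ y ≤ b j := by
  classical
  obtain ⟨L, π, rfl⟩ := hC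
  have hCbdd : Bornology.IsBounded (π '' {M : Matrix (Fin 2) (Fin 2) ℝ | M.PosSemidef ∧ M ∈ L}) :=
    hQ.subset hCQ
  have hsymm : ∀ M : Matrix (Fin 2) (Fin 2) ℝ, M.PosSemidef → M 1 0 = M 0 1 := fun M hM =>
    ((posSemidef_fin_two_iff M).mp hM).1
  -- three affinely independent points and their preimages
  obtain ⟨i₀, i₁, i₂, hδ⟩ := exists_three_points_of_rank_eq_three x a b hrank
  set d₁ : Fin 2 → ℝ := x i₁ - x i₀ with hd₁
  set d₂ : Fin 2 → ℝ := x i₂ - x i₀ with hd₂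
  set δ : ℝ := d₁ 0 * d₂ 1 - d₁ 1 * d₂ 0 with hδdef
  obtain ⟨M₀, ⟨hM₀, hM₀L⟩, hπ₀⟩ := hxC i₀
  obtain ⟨M₁, ⟨hM₁, hM₁L⟩, hπ₁⟩ := hxC i₁
  obtain ⟨M₂, ⟨hM₂, hM₂L⟩, hπ₂⟩ := hxC i₂
  set D₁ : Matrix (Fin 2) (Fin 2) ℝ := M₁ - M₀ with hD₁
  set D₂ : Matrix (Fin 2) (Fin 2) ℝ := M₂ - M₀ with hD₂
  have hπD₁ : π D₁ = d₁ := by rw [hD₁, map_sub, hπ₁, hπ₀]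
  have hπD₂ : π D₂ = d₂ := by rw [hD₂, map_sub, hπ₂, hπ₀]
  have hD₁L : D₁ ∈ L.direction := by
    rw [hD₁, ← vsub_eq_sub]; exact AffineSubspace.vsub_mem_direction hM₁L hM₀L
  have hD₂L : D₂ ∈ L.direction := by
    rw [hD₂, ← vsub_eq_sub]; exact AffineSubspace.vsub_mem_direction hM₂L hM₀L
  have hD₁s : D₁ 1 0 = D₁ 0 1 := by
    simp only [hD₁, Matrix.sub_apply, hsymm M₁ hM₁, hsymm M₀ hM₀]
  have hD₂s : D₂ 1 0 = D₂ 0 1 := by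
    simp only [hD₂, Matrix.sub_apply, hsymm M₂ hM₂, hsymm M₀ hM₀]
  have hM₀s : M₀ 1 0 = M₀ 0 1 := hsymm M₀ hM₀
  -- membership in `L` along directions
  have hmemL : ∀ (s₁ s₂ : ℝ), M₀ + s₁ • D₁ + s₂ • D₂ ∈ L := by
    intro s₁ s₂
    have h := AffineSubspace.vadd_mem_of_mem_direction
      (Submodule.add_mem _ (Submodule.smul_mem _ s₁ hD₁L) (Submodule.smul_mem _ s₂ hD₂L)) hM₀L
    rw [vadd_eq_add] at h
    convert h using 1
    abel
  -- the affine section `N(y) = N₀ + y₀ N₁ + y₁ N₂` of `π`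
  set N₁ : Matrix (Fin 2) (Fin 2) ℝ := (d₂ 1 / δ) • D₁ + (-d₁ 1 / δ) • D₂ with hN₁
  set N₂ : Matrix (Fin 2) (Fin 2) ℝ := (-d₂ 0 / δ) • D₁ + (d₁ 0 / δ) • D₂ with hN₂
  set N₀ : Matrix (Fin 2) (Fin 2) ℝ := M₀ - x i₀ 0 • N₁ - x i₀ 1 • N₂ with hN₀
  let N : (Fin 2 → ℝ) → Matrix (Fin 2) (Fin 2) ℝ := fun y => N₀ + y 0 • N₁ + y 1 • N₂
  have hNdef : ∀ y, N y = N₀ + y 0 • N₁ + y 1 • N₂ := fun y => rfl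
  have hπN₁ : π N₁ = ![1, 0] := by
    rw [hN₁, map_add, map_smul, map_smul, hπD₁, hπD₂]
    ext k
    fin_cases k
    · simp only [Pi.add_apply, Pi.smul_apply, smul_eq_mul, Matrix.cons_val_zero, Fin.zero_eta]
      field_simp
      rw [hδdef]
      ring
    · simp only [Pi.add_apply, Pi.smul_apply, smul_eq_mul, Matrix.cons_val_one, Matrix.cons_val_zero,
        Fin.mk_one]
      field_simp
      ring
  have hπN₂ : π N₂ = ![0, 1] := by
    rw [hN₂, map_add, map_smul, map_smul, hπD₁, hπD₂]
    ext k
    fin_cases k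
    · simp only [Pi.add_apply, Pi.smul_apply, smul_eq_mul, Matrix.cons_val_zero, Fin.zero_eta]
      field_simp
      ring
    · simp only [Pi.add_apply, Pi.smul_apply, smul_eq_mul, Matrix.cons_val_one, Matrix.cons_val_zero,
        Fin.mk_one]
      field_simp
      rw [hδdef]
      ring
  have hπlin : ∀ y : Fin 2 → ℝ, π (y 0 • N₁ + y 1 • N₂) = y := by
    intro y
    rw [map_add, map_smul, map_smul, hπN₁, hπN₂]
    ext k
    fin_cases k <;> simp
  have hπN₀ : π N₀ = 0 := by
    rw [hN₀, map_sub, map_sub, hπ₀, map_smul, map_smul, hπN₁, hπN₂]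
    ext k
    fin_cases k <;> simp [Matrix.vecHead, Matrix.vecTail]
  have hπN : ∀ y, π (N y) = y := by
    intro y
    rw [hNdef, add_assoc, map_add, hπN₀, zero_add, hπlin]
  have hNL : ∀ y, N y ∈ L := by
    intro y
    have h := hmemL (y 0 * (d₂ 1 / δ) + y 1 * (-d₂ 0 / δ) - (x i₀ 0 * (d₂ 1 / δ) + x i₀ 1 * (-d₂ 0 / δ)))
      (y 0 * (-d₁ 1 / δ) + y 1 * (d₁ 0 / δ) - (x i₀ 0 * (-d₁ 1 / δ) + x i₀ 1 * (d₁ 0 / δ)))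
    convert h using 1
    rw [hNdef, hN₀, hN₁, hN₂]
    module
  have hlinL : ∀ y : Fin 2 → ℝ, y 0 • N₁ + y 1 • N₂ ∈ L.direction := by
    intro y
    rw [hN₁, hN₂]
    have h : y 0 • ((d₂ 1 / δ) • D₁ + (-d₁ 1 / δ) • D₂) + y 1 • ((-d₂ 0 / δ) • D₁ + (d₁ 0 / δ) • D₂) =
        (y 0 * (d₂ 1 / δ) + y 1 * (-d₂ 0 / δ)) • D₁ + (y 0 * (-d₁ 1 / δ) + y 1 * (d₁ 0 / δ)) • D₂ := by
      module
    rw [h]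
    exact Submodule.add_mem _ (Submodule.smul_mem _ _ hD₁L) (Submodule.smul_mem _ _ hD₂L)
  -- entries and symmetry of `N`
  have hN₁s : N₁ 1 0 = N₁ 0 1 := by
    simp only [hN₁, Matrix.add_apply, Matrix.smul_apply, smul_eq_mul, hD₁s, hD₂s]
  have hN₂s : N₂ 1 0 = N₂ 0 1 := by
    simp only [hN₂, Matrix.add_apply, Matrix.smul_apply, smul_eq_mul, hD₁s, hD₂s]
  have hN₀s : N₀ 1 0 = N₀ 0 1 := by
    simp only [hN₀, Matrix.sub_apply, Matrix.smul_apply, smul_eq_mul, hM₀s, hN₁s, hN₂s]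
  have hNapply : ∀ y k l, N y k l = N₀ k l + y 0 * N₁ k l + y 1 * N₂ k l := by
    intro y k l
    simp only [hNdef, Matrix.add_apply, Matrix.smul_apply, smul_eq_mul]
  have hNs : ∀ y, N y 1 0 = N y 0 1 := by
    intro y
    rw [hNapply, hNapply, hN₀s, hN₁s, hN₂s]
  have hNx₀ : N (x i₀) = M₀ := by
    ext k l
    simp only [hNdef, hN₀, Matrix.add_apply, Matrix.sub_apply, Matrix.smul_apply, smul_eq_mul]
    ring
  -- uniqueness: every point of the lift is `N` of its image
  have huniq : ∀ M : Matrix (Fin 2) (Fin 2) ℝ, M.PosSemidef → M ∈ L → M = N (π M) := by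
    intro M hM hML
    by_contra hne
    set Dl : Matrix (Fin 2) (Fin 2) ℝ := M - N (π M) with hDl
    have hDl0 : Dl ≠ 0 := sub_ne_zero.mpr hne
    have hDlL : Dl ∈ L.direction := by
      rw [hDl, ← vsub_eq_sub]; exact AffineSubspace.vsub_mem_direction hML (hNL _)
    have hπDl : π Dl = 0 := by rw [hDl, map_sub, hπN, sub_self]
    have hDls : Dl 1 0 = Dl 0 1 := by rw [hDl, Matrix.sub_apply, Matrix.sub_apply, hsymm M hM, hNs]
    -- coordinates of symmetric matrices
    let σ : Matrix (Fin 2) (Fin 2) ℝ → (Fin 3 → ℝ) := fun X => ![X 0 0, X 0 1, X 1 1]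
    have hσ : ∀ X, σ X = ![X 0 0, X 0 1, X 1 1] := fun X => rfl
    set bv : Fin 3 → (Fin 3 → ℝ) := ![σ D₁, σ D₂, σ Dl] with hbv
    have hcomb : ∀ g : Fin 3 → ℝ, ∑ i, g i • bv i = σ (g 0 • D₁ + g 1 • D₂ + g 2 • Dl) := by
      intro g
      rw [Fin.sum_univ_three]
      ext k
      fin_cases k <;> simp [hbv, hσ, Matrix.add_apply, Matrix.smul_apply]
    have hσinj : ∀ X : Matrix (Fin 2) (Fin 2) ℝ, X 1 0 = X 0 1 → σ X = 0 → X = 0 := by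
      intro X hX h0
      have h00 : X 0 0 = 0 := by have := congrFun h0 0; simpa [hσ] using this
      have h01 : X 0 1 = 0 := by have := congrFun h0 1; simpa [hσ] using this
      have h11 : X 1 1 = 0 := by have := congrFun h0 2; simpa [hσ] using this
      ext k l
      fin_cases k <;> fin_cases l
      · exact h00
      · exact h01
      · rw [show X ⟨1, by norm_num⟩ ⟨0, by norm_num⟩ = X 1 0 from rfl, hX, h01]; rfl
      · exact h11
    have hli : LinearIndependent ℝ bv := by
      rw [Fintype.linearIndependent_iff]
      intro g hg
      rw [hcomb] at hg
      set K : Matrix (Fin 2) (Fin 2) ℝ := g 0 • D₁ + g 1 • D₂ + g 2 • Dl with hK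
      have hKs : K 1 0 = K 0 1 := by
        simp only [hK, Matrix.add_apply, Matrix.smul_apply, smul_eq_mul, hD₁s, hD₂s, hDls]
      have hK0 : K = 0 := hσinj K hKs hg
      have hπK : g 0 • d₁ + g 1 • d₂ = 0 := by
        have := congrArg π hK0
        rw [hK, map_add, map_add, map_smul, map_smul, map_smul, hπD₁, hπD₂, hπDl, smul_zero, add_zero,
          map_zero] at this
        exact this
      have e0 : g 0 * d₁ 0 + g 1 * d₂ 0 = 0 := by
        have := congrFun hπK 0; simpa using this
      have e1 : g 0 * d₁ 1 + g 1 * d₂ 1 = 0 := by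
        have := congrFun hπK 1; simpa using this
      have hg0 : g 0 = 0 := by
        have : g 0 * δ = 0 := by rw [hδdef]; linear_combination d₂ 1 * e0 - d₂ 0 * e1
        exact (mul_eq_zero.mp this).resolve_right hδ
      have hg1 : g 1 = 0 := by
        have : g 1 * δ = 0 := by rw [hδdef]; linear_combination -(d₁ 1) * e0 + d₁ 0 * e1
        exact (mul_eq_zero.mp this).resolve_right hδ
      have hg2 : g 2 = 0 := by
        rw [hg0, hg1, zero_smul, zero_smul, zero_add, zero_add] at hK
        have : g 2 • Dl = 0 := by rw [← hK]; exact hK0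
        exact (smul_eq_zero.mp this).resolve_right hDl0
      intro i
      fin_cases i
      · exact hg0
      · exact hg1
      · exact hg2
    have hspan : Submodule.span ℝ (Set.range bv) = ⊤ :=
      hli.span_eq_top_of_card_eq_finrank' (by simp)
    -- every symmetric matrix is a direction of `L`
    have hdir : ∀ E : Matrix (Fin 2) (Fin 2) ℝ, E 1 0 = E 0 1 → E ∈ L.direction := by
      intro E hE
      have hmem : σ E ∈ Submodule.span ℝ (Set.range bv) := by rw [hspan]; exact Submodule.mem_top
      obtain ⟨g, hg⟩ := (Submodule.mem_span_range_iff_exists_fun (R := ℝ)).mp hmem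
      rw [hcomb] at hg
      have hE' : E = g 0 • D₁ + g 1 • D₂ + g 2 • Dl := by
        have h0 : σ (E - (g 0 • D₁ + g 1 • D₂ + g 2 • Dl)) = 0 := by
          have : σ (E - (g 0 • D₁ + g 1 • D₂ + g 2 • Dl)) = σ E - σ (g 0 • D₁ + g 1 • D₂ + g 2 • Dl) := by
            ext k; fin_cases k <;> simp [hσ]
          rw [this, hg, sub_self]
        have hs : (E - (g 0 • D₁ + g 1 • D₂ + g 2 • Dl)) 1 0 = (E - (g 0 • D₁ + g 1 • D₂ + g 2 • Dl)) 0 1 := by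
          simp only [Matrix.sub_apply, Matrix.add_apply, Matrix.smul_apply, smul_eq_mul, hE, hD₁s, hD₂s, hDls]
        exact sub_eq_zero.mp (hσinj _ hs h0)
      rw [hE']
      exact Submodule.add_mem _ (Submodule.add_mem _ (Submodule.smul_mem _ _ hD₁L)
        (Submodule.smul_mem _ _ hD₂L)) (Submodule.smul_mem _ _ hDlL)
    -- psd directions give rays: `π` vanishes on psd matrices
    have hray : ∀ E : Matrix (Fin 2) (Fin 2) ℝ, E.PosSemidef → π E = 0 := by
      intro E hE
      have hEdir := hdir E (hsymm E hE)
      refine eq_zero_of_ray_subset hCbdd (y := π M₀) (z := π E) fun t ht => ?_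
      refine ⟨M₀ + t • E, ⟨hM₀.add (hE.smul ht), ?_⟩, by rw [map_add, map_smul]⟩
      have h := AffineSubspace.vadd_mem_of_mem_direction (Submodule.smul_mem _ t hEdir) hM₀L
      rw [vadd_eq_add, add_comm] at h
      exact h
    have h00 := hray _ (posSemidef_single_fin_two 0)
    have h11 := hray _ (posSemidef_single_fin_two 1)
    have hJ := hray _ posSemidef_ones_fin_two
    have hdec : D₁ = (D₁ 0 0 - D₁ 0 1) • Matrix.single 0 0 (1 : ℝ) + (D₁ 1 1 - D₁ 0 1) • Matrix.single 1 1 (1 : ℝ) +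
        D₁ 0 1 • Matrix.of (fun (_ _ : Fin 2) => (1 : ℝ)) := by
      ext k l
      fin_cases k <;> fin_cases l <;> simp [hD₁s]
    have hπD₁0 : π D₁ = 0 := by
      rw [hdec, map_add, map_add, map_smul, map_smul, map_smul, h00, h11, hJ, smul_zero, smul_zero, smul_zero,
        add_zero, add_zero]
    apply hδ
    show d₁ 0 * d₂ 1 - d₁ 1 * d₂ 0 = 0
    rw [← hπD₁, hπD₁0]
    simp
  -- hence `C = {y : N(y) ⪰ 0}`
  have hCiff : ∀ y, y ∈ π '' {M : Matrix (Fin 2) (Fin 2) ℝ | M.PosSemidef ∧ M ∈ L} ↔ (N y).PosSemidef := by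
    intro y
    constructor
    · rintro ⟨M, ⟨hM, hML⟩, rfl⟩
      rw [← huniq M hM hML]
      exact hM
    · intro h
      exact ⟨N y, ⟨h, hNL y⟩, hπN y⟩
  -- the quadratic `q(y) = −det N(y) = yᵀAy + 2cᵀy + γ`
  set A : Matrix (Fin 2) (Fin 2) ℝ := !![N₁ 0 1 ^ 2 - N₁ 0 0 * N₁ 1 1,
      N₁ 0 1 * N₂ 0 1 - (N₁ 0 0 * N₂ 1 1 + N₂ 0 0 * N₁ 1 1) / 2;
    N₁ 0 1 * N₂ 0 1 - (N₁ 0 0 * N₂ 1 1 + N₂ 0 0 * N₁ 1 1) / 2, N₂ 0 1 ^ 2 - N₂ 0 0 * N₂ 1 1] with hA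
  set c : Fin 2 → ℝ := ![N₀ 0 1 * N₁ 0 1 - (N₀ 0 0 * N₁ 1 1 + N₁ 0 0 * N₀ 1 1) / 2,
    N₀ 0 1 * N₂ 0 1 - (N₀ 0 0 * N₂ 1 1 + N₂ 0 0 * N₀ 1 1) / 2] with hc
  set γ : ℝ := N₀ 0 1 ^ 2 - N₀ 0 0 * N₀ 1 1 with hγ
  have hA00 : A 0 0 = N₁ 0 1 ^ 2 - N₁ 0 0 * N₁ 1 1 := by simp [hA]
  have hA01 : A 0 1 = N₁ 0 1 * N₂ 0 1 - (N₁ 0 0 * N₂ 1 1 + N₂ 0 0 * N₁ 1 1) / 2 := by simp [hA]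
  have hA10 : A 1 0 = N₁ 0 1 * N₂ 0 1 - (N₁ 0 0 * N₂ 1 1 + N₂ 0 0 * N₁ 1 1) / 2 := by simp [hA]
  have hA11 : A 1 1 = N₂ 0 1 ^ 2 - N₂ 0 0 * N₂ 1 1 := by simp [hA]
  have hc0 : c 0 = N₀ 0 1 * N₁ 0 1 - (N₀ 0 0 * N₁ 1 1 + N₁ 0 0 * N₀ 1 1) / 2 := by simp [hc]
  have hc1 : c 1 = N₀ 0 1 * N₂ 0 1 - (N₀ 0 0 * N₂ 1 1 + N₂ 0 0 * N₀ 1 1) / 2 := by simp [hc]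
  have hq : ∀ y : Fin 2 → ℝ, y ⬝ᵥ (A *ᵥ y) + 2 * (c ⬝ᵥ y) + γ = N y 0 1 ^ 2 - N y 0 0 * N y 1 1 := by
    intro y
    rw [dotProduct_mulVec_fin_two, hA00, hA01, hA10, hA11, hNapply, hNapply, hNapply]
    simp only [dotProduct, Fin.sum_univ_two, hc0, hc1, hγ]
    ring
  have hAform : ∀ y : Fin 2 → ℝ, y ⬝ᵥ (A *ᵥ y) =
      (y 0 • N₁ + y 1 • N₂) 0 1 ^ 2 - (y 0 • N₁ + y 1 • N₂) 0 0 * (y 0 • N₁ + y 1 • N₂) 1 1 := by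
    intro y
    rw [dotProduct_mulVec_fin_two, hA00, hA01, hA10, hA11]
    simp only [Matrix.add_apply, Matrix.smul_apply, smul_eq_mul]
    ring
  -- `A ≻ 0`: a semidefinite direction would give a ray in `C`
  have hApos : A.PosDef := by
    refine PosDef.of_dotProduct_mulVec_pos ?_ fun y hy => ?_
    · ext k l
      fin_cases k <;> fin_cases l <;> simp [hA]
    rw [star_trivial]
    by_contra hle
    push Not at hle
    set Dy : Matrix (Fin 2) (Fin 2) ℝ := y 0 • N₁ + y 1 • N₂ with hDy
    have hDys : Dy 1 0 = Dy 0 1 := by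
      simp only [hDy, Matrix.add_apply, Matrix.smul_apply, smul_eq_mul, hN₁s, hN₂s]
    have hdet : Dy 0 1 ^ 2 ≤ Dy 0 0 * Dy 1 1 := by rw [hAform] at hle; linarith
    have hπDy : π Dy = y := hπlin y
    -- a psd direction `±Dy` spans a ray from `x i₀`
    have hrayD : ∀ D : Matrix (Fin 2) (Fin 2) ℝ, D.PosSemidef → D ∈ L.direction → π D = 0 := by
      intro D hD hDL
      refine eq_zero_of_ray_subset hCbdd (y := π M₀) (z := π D) fun t ht => ?_
      refine ⟨M₀ + t • D, ⟨hM₀.add (hD.smul ht), ?_⟩, by rw [map_add, map_smul]⟩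
      have h := AffineSubspace.vadd_mem_of_mem_direction (Submodule.smul_mem _ t hDL) hM₀L
      rw [vadd_eq_add, add_comm] at h
      exact h
    rcases le_or_gt 0 (Dy 0 0 + Dy 1 1) with htr | htr
    · have hpsd : Dy.PosSemidef := posSemidef_fin_two_of_det_of_trace Dy hDys hdet htr
      have := hrayD Dy hpsd (hlinL y)
      rw [hπDy] at this
      exact hy this
    · have hpsd : (-Dy).PosSemidef := by
        refine posSemidef_fin_two_of_det_of_trace (-Dy) ?_ ?_ ?_
        · simp only [Matrix.neg_apply, hDys]
        · simp only [Matrix.neg_apply]; nlinarith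
        · simp only [Matrix.neg_apply]; linarith
      have := hrayD (-Dy) hpsd (Submodule.neg_mem _ (hlinL y))
      rw [map_neg, hπDy, neg_eq_zero] at this
      exact hy this
  refine ⟨A, c, γ, hApos, fun i => ?_, fun y hy => ?_⟩
  · -- the points lie in `E`
    have hNi : (N (x i)).PosSemidef := (hCiff (x i)).mp (hxC i)
    obtain ⟨-, -, -, hdet⟩ := (posSemidef_fin_two_iff _).mp hNi
    rw [hq]
    linarith
  · -- `E ⊆ C ⊆ Q`
    apply hCQ
    rw [hCiff]
    have hdet : N y 0 1 ^ 2 ≤ N y 0 0 * N y 1 1 := by rw [hq] at hy; linarith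
    by_contra hnot
    have htr : N y 0 0 + N y 1 1 < 0 := by
      by_contra h
      push Not at h
      exact hnot (posSemidef_fin_two_of_det_of_trace _ (hNs y) hdet h)
    -- along the segment from `x i₀` to `y`: `N(z_t) = M₀ + t (N y − M₀)`, `q(z_t) ≤ 0`
    have hseg : ∀ t : ℝ, N (x i₀ + t • (y - x i₀)) = M₀ + t • (N y - M₀) := by
      intro t
      rw [← hNx₀, hNdef, hNdef, hNdef]
      ext k l
      simp only [Matrix.add_apply, Matrix.smul_apply, Matrix.sub_apply, smul_eq_mul, Pi.add_apply,
        Pi.smul_apply, Pi.sub_apply]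
      ring
    have hqx₀ : x i₀ ⬝ᵥ (A *ᵥ x i₀) + 2 * (c ⬝ᵥ x i₀) + γ ≤ 0 := by
      obtain ⟨-, -, -, hdet₀⟩ := (posSemidef_fin_two_iff _).mp hM₀
      rw [hq, hNx₀]
      linarith
    have hconv : ∀ t : ℝ, 0 ≤ t → t ≤ 1 →
        (x i₀ + t • (y - x i₀)) ⬝ᵥ (A *ᵥ (x i₀ + t • (y - x i₀))) + 2 * (c ⬝ᵥ (x i₀ + t • (y - x i₀))) + γ ≤ 0 := by
      intro t ht0 ht1
      have hid : (x i₀ + t • (y - x i₀)) ⬝ᵥ (A *ᵥ (x i₀ + t • (y - x i₀))) + 2 * (c ⬝ᵥ (x i₀ + t • (y - x i₀))) + γ =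
          (1 - t) * (x i₀ ⬝ᵥ (A *ᵥ x i₀) + 2 * (c ⬝ᵥ x i₀) + γ) + t * (y ⬝ᵥ (A *ᵥ y) + 2 * (c ⬝ᵥ y) + γ) -
            t * (1 - t) * ((y - x i₀) ⬝ᵥ (A *ᵥ (y - x i₀))) := by
        rw [dotProduct_mulVec_fin_two, dotProduct_mulVec_fin_two, dotProduct_mulVec_fin_two,
          dotProduct_mulVec_fin_two]
        simp only [dotProduct, Fin.sum_univ_two, Pi.add_apply, Pi.smul_apply, Pi.sub_apply, smul_eq_mul]
        ring
      rw [hid]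
      have h3 : 0 ≤ (y - x i₀) ⬝ᵥ (A *ᵥ (y - x i₀)) := by
        simpa using hApos.posSemidef.dotProduct_mulVec_nonneg (y - x i₀)
      have h1 : 0 ≤ 1 - t := by linarith
      have e1 : (1 - t) * (x i₀ ⬝ᵥ (A *ᵥ x i₀) + 2 * (c ⬝ᵥ x i₀) + γ) ≤ 0 :=
        mul_nonpos_iff.mpr (Or.inl ⟨h1, hqx₀⟩)
      have e2 : t * (y ⬝ᵥ (A *ᵥ y) + 2 * (c ⬝ᵥ y) + γ) ≤ 0 := mul_nonpos_iff.mpr (Or.inl ⟨ht0, hy⟩)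
      have e3 : 0 ≤ t * (1 - t) * ((y - x i₀) ⬝ᵥ (A *ᵥ (y - x i₀))) := mul_nonneg (mul_nonneg ht0 h1) h3
      linarith
    -- the trace of `N(z_t)` vanishes at `t_c ∈ [0, 1)`
    have htr₀ : 0 ≤ M₀ 0 0 + M₀ 1 1 := by
      obtain ⟨-, h0, h1, -⟩ := (posSemidef_fin_two_iff _).mp hM₀
      linarith
    set tc : ℝ := (M₀ 0 0 + M₀ 1 1) / ((M₀ 0 0 + M₀ 1 1) - (N y 0 0 + N y 1 1)) with htc
    have hden : 0 < (M₀ 0 0 + M₀ 1 1) - (N y 0 0 + N y 1 1) := by linarith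
    have htc0 : 0 ≤ tc := div_nonneg htr₀ hden.le
    have htc1 : tc ≤ 1 := by rw [htc, div_le_one hden]; linarith
    set Z : Matrix (Fin 2) (Fin 2) ℝ := N (x i₀ + tc • (y - x i₀)) with hZ
    have hZeq : Z = M₀ + tc • (N y - M₀) := hseg tc
    have hZtr : Z 0 0 + Z 1 1 = 0 := by
      rw [hZeq]
      simp only [Matrix.add_apply, Matrix.smul_apply, Matrix.sub_apply, smul_eq_mul]
      rw [htc]
      field_simp
      ring
    have hZdet : Z 0 1 ^ 2 ≤ Z 0 0 * Z 1 1 := by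
      have := hconv tc htc0 htc1
      rw [hq] at this
      linarith
    have hZ0 : Z = 0 := eq_zero_fin_two_of_det_of_trace Z (hNs _) hZdet hZtr
    -- so `z_{t_c} = π(0) = 0` and `N₀ = 0`: `C` is a cone
    have hz0 : x i₀ + tc • (y - x i₀) = 0 := by
      rw [← hπN (x i₀ + tc • (y - x i₀))]
      show π Z = 0
      rw [hZ0, map_zero]
    have hN₀0 : N₀ = 0 := by
      have h := hZ0
      rw [hZ, hz0, hNdef] at h
      simpa using h
    have hcone : ∀ (w : Fin 2 → ℝ) (t : ℝ), 0 ≤ t →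
        w ∈ π '' {M : Matrix (Fin 2) (Fin 2) ℝ | M.PosSemidef ∧ M ∈ L} →
        t • w ∈ π '' {M : Matrix (Fin 2) (Fin 2) ℝ | M.PosSemidef ∧ M ∈ L} := by
      intro w t ht hw
      rw [hCiff] at hw ⊢
      have : N (t • w) = t • N w := by
        rw [hNdef, hNdef, hN₀0]
        simp only [Pi.smul_apply, smul_eq_mul, zero_add, smul_add, smul_smul]
      rw [this]
      exact hw.smul ht
    -- one of `x i₀`, `x i₁` is nonzero, and its ray lies in `C`
    have hw : ∃ i, x i ≠ 0 := by
      by_contra h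
      push Not at h
      apply hδ
      show d₁ 0 * d₂ 1 - d₁ 1 * d₂ 0 = 0
      rw [hd₁, h i₁, h i₀, sub_zero]
      simp
    obtain ⟨i, hi⟩ := hw
    refine hi (eq_zero_of_ray_subset hCbdd (y := 0) (z := x i) fun t ht => ?_)
    rw [zero_add]
    exact hcone (x i) t ht (hxC i)

/-- **Discharge of `FawziEtAl2015_sec4_ellipse`** (§4, from GRT13 Prop. 4.1: for a rank-`3` slack matrix of
points inside a bounded planar `Q`, `rank_psd = 2` iff a (nondegenerate) ellipse is sandwiched).
"⇐": the ellipse region has a psd lift of size `2` (`hasPsdLift_ellipse`) sandwiched between the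
points and `Q`, so Theorem 3.3's direction `HasPsdLift.hasPsdFactorization_pairSlackMatrix` applies;
"⇒": Theorem 3.3's `HasPsdFactorization.exists_hasPsdLift_between` gives a sandwiched lift of size `2`,
and `exists_ellipse_of_hasPsdLift_two` turns it into an ellipse. [cite: FawziEtAl2015, §4 (p13)] -/
theorem FawziEtAl2015_sec4_ellipse_holds : FawziEtAl2015_sec4_ellipse := by
  intro v f x a b hxQ hQ hrank
  constructor
  · intro h
    obtain ⟨C, hPC, hCQ, hC⟩ := h.exists_hasPsdLift_between (by norm_num) hQ
    exact exists_ellipse_of_hasPsdLift_two hQ hrank hC (fun i => hPC (subset_convexHull ℝ _ ⟨i, rfl⟩)) hCQ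
  · rintro ⟨A, c, γ, hA, hP, hEQ⟩
    exact (hasPsdLift_ellipse A c γ hA).hasPsdFactorization_pairSlackMatrix (by norm_num)
      (fun i => hP i) (fun y hy => hEQ y hy) hQ

end Sec4Ellipse

/-! ### Corollary 5.9, rank part: the slack matrix of an `n`-dimensional polytope has rank `n + 1` -/

section RankSlack

/-- **Corollary 5.9, rank part: `rank(S_P) = dim P + 1`.**  For a `V`/`H`-described polytope
`P = conv{x_i} = {y : a_jᵀy ≤ b_j ∀ j}` of dimension `n ≥ 1` the slack matrix
`S_P = (b_j − a_jᵀx_i)_{ij}` has rank exactly `n + 1`: its rows are `L(x_i − x_{i₀}) + s_{i₀}` with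
`L w = (−a_jᵀw)_j` injective (a direction `w` with `a_jᵀw = 0 ∀ j` would make `P` unbounded) and
`s_{i₀} ∉ L(lin P)` (else some point of `aff P` is tight on every facet inequality, and again `P` would
contain a ray), so the row space is `L(lin P) ⊕ ℝ s_{i₀}`. [cite: FawziEtAl2015, Cor. 5.9 (p15)] -/
theorem rank_pairSlackMatrix_eq_finrank_add_one {d v f n : ℕ} (x : Fin v → (Fin d → ℝ))
    (a : Fin f → (Fin d → ℝ)) (b : Fin f → ℝ) (hn : 1 ≤ n)
    (hdim : Module.finrank ℝ (vectorSpan ℝ (Set.range x)) = n)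
    (hP : convexHull ℝ (Set.range x) = {y | ∀ j, a j ⬝ᵥ y ≤ b j}) :
    (Matrix.of (pairSlackMatrix x a b)).rank = n + 1 := by
  classical
  -- an index `i₀`
  rcases Nat.eq_zero_or_pos v with hv | hv
  · subst hv
    exfalso
    have h0 : vectorSpan ℝ (Set.range x) = ⊥ := by
      rw [Set.range_eq_empty x, vectorSpan_empty]
    rw [h0, finrank_bot] at hdim
    omega
  obtain ⟨i₀⟩ : Nonempty (Fin v) := ⟨⟨0, hv⟩⟩
  -- `Q = P` is bounded and contains the `x_i`
  have hQbdd : Bornology.IsBounded {y : Fin d → ℝ | ∀ j, a j ⬝ᵥ y ≤ b j} := by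
    rw [← hP]; exact isBounded_convexHull.mpr (Set.finite_range x).isBounded
  have hxQ : ∀ i j, a j ⬝ᵥ x i ≤ b j := fun i => by
    have hi : x i ∈ {y : Fin d → ℝ | ∀ j, a j ⬝ᵥ y ≤ b j} := by
      rw [← hP]; exact subset_convexHull ℝ _ (Set.mem_range_self i)
    exact hi
  -- the linear map `L w = (−a_jᵀ w)_j`, the direction space `V` and the row `s₀`
  let L : (Fin d → ℝ) →ₗ[ℝ] (Fin f → ℝ) :=
    { toFun := fun w j => -(a j ⬝ᵥ w)
      map_add' := fun w w' => by
        ext j; simp only [Pi.add_apply, dotProduct_add, neg_add]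
      map_smul' := fun c w => by
        ext j; simp only [Pi.smul_apply, smul_eq_mul, dotProduct_smul, RingHom.id_apply, mul_neg] }
  have hL : ∀ w j, L w j = -(a j ⬝ᵥ w) := fun w j => rfl
  set V : Submodule ℝ (Fin d → ℝ) := vectorSpan ℝ (Set.range x) with hV
  set S : Matrix (Fin v) (Fin f) ℝ := Matrix.of (pairSlackMatrix x a b) with hS
  set s₀ : Fin f → ℝ := S.row i₀ with hs₀_def
  have hSrow : ∀ i j, S.row i j = b j - a j ⬝ᵥ x i := fun i j => rfl
  have hrow : ∀ i, S.row i = L (x i - x i₀) + s₀ := by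
    intro i; ext j
    rw [Pi.add_apply, hL, hSrow, hs₀_def, hSrow, dotProduct_sub]
    ring
  have hVmem : ∀ i k, x i - x k ∈ V := fun i k => by
    rw [hV, ← vsub_eq_sub]
    exact vsub_mem_vectorSpan ℝ (Set.mem_range_self i) (Set.mem_range_self k)
  -- (1) the row span is `L(V) ⊔ ℝ s₀`
  have hspan : Submodule.span ℝ (Set.range S.row) = V.map L ⊔ Submodule.span ℝ {s₀} := by
    apply le_antisymm
    · rw [Submodule.span_le]
      rintro _ ⟨i, rfl⟩
      rw [SetLike.mem_coe, hrow i]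
      exact Submodule.add_mem_sup (Submodule.mem_map_of_mem (hVmem i i₀))
        (Submodule.mem_span_singleton_self s₀)
    · have hs₀mem : s₀ ∈ Submodule.span ℝ (Set.range S.row) := Submodule.subset_span ⟨i₀, rfl⟩
      refine sup_le ?_ ((Submodule.span_singleton_le_iff_mem _ _).mpr hs₀mem)
      rw [hV, vectorSpan_def, Submodule.map_span, Submodule.span_le]
      rintro _ ⟨w, hw, rfl⟩
      rw [Set.mem_vsub] at hw
      obtain ⟨p, ⟨i, rfl⟩, q, ⟨k, rfl⟩, rfl⟩ := hw
      have h1 : L (x i -ᵥ x k) = S.row i - S.row k := by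
        rw [vsub_eq_sub, ← sub_sub_sub_cancel_right (x i) (x k) (x i₀), map_sub, hrow i, hrow k]
        abel
      rw [SetLike.mem_coe, h1]
      exact Submodule.sub_mem _ (Submodule.subset_span ⟨i, rfl⟩) (Submodule.subset_span ⟨k, rfl⟩)
  -- (2) `L` is injective (a common kernel direction of the `a_j` would make `P` unbounded)
  have hLinj : Function.Injective L := by
    have hker : ∀ w, L w = 0 → w = 0 := by
      intro w hLw
      have hzero : ∀ j, a j ⬝ᵥ w = 0 := fun j => by
        have := congrFun hLw j
        rw [hL, Pi.zero_apply, neg_eq_zero] at this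
        exact this
      refine eq_zero_of_ray_subset hQbdd (y := x i₀) fun t _ => ?_
      show ∀ j, a j ⬝ᵥ (x i₀ + t • w) ≤ b j
      intro j
      rw [dotProduct_add, dotProduct_smul, hzero j, smul_zero, add_zero]
      exact hxQ i₀ j
    intro w w' h
    exact sub_eq_zero.mp (hker (w - w') (by rw [map_sub, h, sub_self]))
  have hfinV : Module.finrank ℝ (V.map L) = n := by
    rw [← hdim]
    exact (LinearEquiv.finrank_eq (Submodule.equivMapOfInjective L hLinj V)).symm
  -- (3) `s₀ ∉ L(V)` (else a point of `aff P` is tight on all inequalities and `P` contains rays)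
  have hs₀ : s₀ ∉ V.map L := by
    rintro ⟨w, hw, hws⟩
    have htight : ∀ j, a j ⬝ᵥ (x i₀ - w) = b j := fun j => by
      have := congrFun hws j
      rw [hL, hs₀_def, hSrow] at this
      rw [dotProduct_sub]; linarith
    have hall : ∀ i, x i = x i₀ - w := by
      intro i
      have hz := eq_zero_of_ray_subset hQbdd (y := x i) (z := x i - (x i₀ - w)) fun t ht => by
        show ∀ j, a j ⬝ᵥ (x i + t • (x i - (x i₀ - w))) ≤ b j
        intro j
        rw [dotProduct_add, dotProduct_smul, dotProduct_sub, htight j, smul_eq_mul]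
        nlinarith [hxQ i j]
      exact sub_eq_zero.mp hz
    have hrange : Set.range x = {x i₀ - w} := by
      ext y
      simp only [Set.mem_range, Set.mem_singleton_iff]
      constructor
      · rintro ⟨i, rfl⟩; exact hall i
      · rintro rfl; exact ⟨i₀, hall i₀⟩
    have h0 : Module.finrank ℝ V = 0 := by
      rw [hV, hrange, vectorSpan_singleton, finrank_bot]
    omega
  have hs₀ne : s₀ ≠ 0 := fun h => hs₀ (h ▸ Submodule.zero_mem _)
  -- (4) dimension count
  rw [Matrix.rank_eq_finrank_span_row, hspan]
  have hdisj : V.map L ⊓ Submodule.span ℝ {s₀} = ⊥ :=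
    disjoint_iff.mp ((Submodule.disjoint_span_singleton' hs₀ne).mpr hs₀)
  have key := Submodule.finrank_sup_add_finrank_inf_eq (V.map L) (Submodule.span ℝ {s₀})
  rw [hdisj, finrank_bot, add_zero, hfinV, finrank_span_singleton hs₀ne] at key
  exact key

end RankSlack

end Literature.Combinatorics.Optimization
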